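import Literature.Analysis.FluidPDE.ConeCarlemanWeight
import HarnessLib

/-!
# The Carleman inequality in a cone (Li–Šverák 2012, Prop. 2.3), proved

Analysis/FluidPDE support file (theorems only; no definitions, no named facts) for the proof of
Li–Šverák's backward-uniqueness theorem in cones
(`Literature.Analysis.FluidPDE.coneBackwardUniquenessC12`). With the weight of
`ConeCarlemanWeight` (`φ = t² + a k₁(t) φ₀(x)`, `φ₀ = ⟪x,e⟫^{2β} - η(‖x‖²)^β`, `η = ε^{2β}`,
`k₁ = (1-t)/t`) we prove Proposition 2.3 of the paper in Seregin's `t`-weighted `L₂` form: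

  `∫ ((c₂/2)a²k₁ + aφ₀) e^{2φ}|u|² + ½∫ t e^{2φ}|∇u|² ≤ ∫ t² e^{2φ}|∂ₜu + Δu|²`

for smooth `u` compactly supported in `]0,1[ × ({ε|x| < ⟪x,e⟫} ∩ {⟪x,e⟫ > 1})`, whenever
`1/2 < β ≤ 1`, `m(2β, ε) ≥ 0`, `2β - 1 - 2η ≥ 0`, `c₂(β, η) > 0`, `a c₂ ≥ 2(1-β)·9(d+4)²`
(`carleman_inequality_cone`). The file follows §4 of the paper on top of the tree's machinery
(`CarlemanCommutator`: Seregin's splitting `tL = S + A` and the identity (A.1.6);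
`CarlemanConjugate`):

* `cone_cubic_nonneg`, `cone_quadratic_bound`, `cone_linear_junk_bound`, `cone_pointwise_core` —
  the pointwise algebra of (4.8)–(4.18) (orders `a³`, `a²`, `a¹`) in the atoms
  `u = x₁^{α-2}`, `w = |x|^{α-2}`;
* `cone_atom_facts`, `cone_weight_lower_bound` — from the frame objects to the atoms;
* `integral_mul_inner_lap_self_of_open` — Green's formula with a smooth multiplier;
* `cone_hess_gradient_nonneg`, `multiplier_le_integral_opSW_opAW_sq` — Li–Šverák's compensating
  multiplier `F` ((4.3)–(4.7)), here `G = 2t a k₁ f`, `f = αε^α|x|^{α-2}`;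
* `carleman_inequality_cone` — the assembly.

All statements are proved.

## References

* L. Li, V. Šverák, *Backward uniqueness for the heat equation in cones*, Comm. PDE 37 (2012)
  1414–1429, arXiv:1011.2796, Prop. 2.3 and §4. [LiSverak2012]
* G. Seregin, *Lecture notes on regularity theory for the Navier–Stokes equations*, World
  Scientific 2014, App. A.1. [Seregin2014]
-/

noncomputable section

open MeasureTheory Set Function Filter
open _root_.Topology
open scoped InnerProductSpace RealInnerProductSpace

namespace Literature.Analysis.FluidPDE

namespace Carleman

/-! ### The pointwise algebra of Li–Šverák §4 (orders `a³`, `a²`, `a¹`)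

Pure real inequalities. Variables: `s = ⟪x,e⟫ ≥ 1`, `R = ‖x‖² ≥ s²`, the atoms `u = s^{2β-2}`,
`w = R^{β-1}` (so `x₁^{α-1} = us`, `x₁^α = us²`, `|x|^α = wR`, with `α = 2β`), `η = ε^α`,
`ε2 = ε²`; the hypotheses `w ≤ u`, `η w R ≤ u s²`, `u s² ≤ w R`, `η² w² R ≤ ε2 u² s²`,
`ε2 R ≤ s²` are the monotonicity facts `|x|^{α-2} ≤ x₁^{α-2}`, `ε^α|x|^α ≤ x₁^α ≤ |x|^α`,
`(ε|x|)^{2α-2} ≤ x₁^{2α-2}`, `ε|x| ≤ x₁` of the cone `{x₁ > ε|x|} ∩ {x₁ > 1}`. -/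

section ConePointwise

/-- **The `a³`-term is nonnegative** (paper, (4.9)–(4.12)): with `g₁ = 2βs(u - ηw) = φ₀,₁`,
`|∇φ₀|² = g₁² + 4β²η²w²(R - s²)`, `c₁ = 2β(2β-1)u = α(α-1)x₁^{α-2}`, `f = 2βηw = αε^α|x|^{α-2}`,
`c₁ g₁² - 2f |∇φ₀|² ≥ 8β³u³s² m(α, ε) ≥ 0`, where
`m = (2β-1-2η)(1-η)² - 2ηε²(1-ε²)` (`= (α-1-2ε^α)(1-ε^α)² - 2ε^{α+2}(1-ε²)`). [cite: LiSverak2012, §4 (4.9)–(4.12)] -/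
theorem cone_cubic_nonneg {β η ε2 s R u w : ℝ} (hβ : 0 ≤ β) (hη0 : 0 ≤ η) (hη1 : η ≤ 1)
    (hε1 : ε2 ≤ 1) (hR0 : 0 ≤ R) (hu : 0 ≤ u) (hw : 0 ≤ w) (hwu : w ≤ u)
    (hR : ε2 * R ≤ s ^ 2) (h3 : η ^ 2 * w ^ 2 * R ≤ ε2 * u ^ 2 * s ^ 2)
    (hκ : 0 ≤ 2 * β - 1 - 2 * η)
    (hm : 0 ≤ (2 * β - 1 - 2 * η) * (1 - η) ^ 2 - 2 * η * ε2 * (1 - ε2)) :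
    0 ≤ (2 * β * (2 * β - 1) * u) * (2 * β * s * (u - η * w)) ^ 2 -
      2 * (2 * β * η * w) * ((2 * β * s * (u - η * w)) ^ 2 + 4 * β ^ 2 * η ^ 2 * w ^ 2 * (R - s ^ 2)) := by
  -- `D = u - ηw ≥ u(1-η) ≥ 0`
  have hD1 : u * (1 - η) ≤ u - η * w := by nlinarith
  have hD0 : 0 ≤ u * (1 - η) := mul_nonneg hu (by linarith)
  have hDsq : (u * (1 - η)) ^ 2 ≤ (u - η * w) ^ 2 := pow_le_pow_left₀ hD0 hD1 2
  -- the coefficient `c₁ - 2f ≥ 2βu(2β-1-2η) ≥ 0`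
  have hc : 2 * β * u * (2 * β - 1 - 2 * η) ≤ 2 * β * (2 * β - 1) * u - 2 * (2 * β * η * w) := by
    nlinarith [mul_nonneg hβ hη0]
  have hc0 : 0 ≤ 2 * β * u * (2 * β - 1 - 2 * η) := by positivity
  -- first term
  have hT1 : 2 * β * u * (2 * β - 1 - 2 * η) * (4 * β ^ 2 * s ^ 2 * (u * (1 - η)) ^ 2) ≤
      (2 * β * (2 * β - 1) * u - 2 * (2 * β * η * w)) * (2 * β * s * (u - η * w)) ^ 2 := by
    have h1 : 4 * β ^ 2 * s ^ 2 * (u * (1 - η)) ^ 2 ≤ (2 * β * s * (u - η * w)) ^ 2 := by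
      have : (2 * β * s * (u - η * w)) ^ 2 = 4 * β ^ 2 * s ^ 2 * (u - η * w) ^ 2 := by ring
      rw [this]
      exact mul_le_mul_of_nonneg_left hDsq (by positivity)
    exact mul_le_mul hc h1 (by positivity) (le_trans hc0 hc)
  -- the junk term `2f |g'|² = 16β³η³w³(R - s²) ≤ 16β³ η ε2 (1 - ε2) u³ s²`
  have hT2 : 2 * (2 * β * η * w) * (4 * β ^ 2 * η ^ 2 * w ^ 2 * (R - s ^ 2)) ≤
      16 * β ^ 3 * (η * ε2 * (1 - ε2) * (u ^ 3 * s ^ 2)) := by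
    have e1 : R - s ^ 2 ≤ R * (1 - ε2) := by nlinarith
    have j1 : η ^ 3 * w ^ 3 * (R - s ^ 2) ≤ η ^ 3 * w ^ 3 * (R * (1 - ε2)) :=
      mul_le_mul_of_nonneg_left e1 (by positivity)
    have j3 : η * w * (1 - ε2) * (η ^ 2 * w ^ 2 * R) ≤ η * w * (1 - ε2) * (ε2 * u ^ 2 * s ^ 2) :=
      mul_le_mul_of_nonneg_left h3 (mul_nonneg (mul_nonneg hη0 hw) (by linarith))
    have j4 : η * w * (1 - ε2) * (ε2 * u ^ 2 * s ^ 2) ≤ η * u * (1 - ε2) * (ε2 * u ^ 2 * s ^ 2) := by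
      have hK : 0 ≤ η * (1 - ε2) * (ε2 * u ^ 2 * s ^ 2) := by
        have hε0 : 0 ≤ ε2 * u ^ 2 * s ^ 2 := le_trans (by positivity) h3
        exact mul_nonneg (mul_nonneg hη0 (by linarith)) hε0
      nlinarith [mul_le_mul_of_nonneg_left hwu hK]
    have e2 : 2 * (2 * β * η * w) * (4 * β ^ 2 * η ^ 2 * w ^ 2 * (R - s ^ 2)) =
        16 * β ^ 3 * (η ^ 3 * w ^ 3 * (R - s ^ 2)) := by ring
    have e3 : η ^ 3 * w ^ 3 * (R * (1 - ε2)) = η * w * (1 - ε2) * (η ^ 2 * w ^ 2 * R) := by ring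
    rw [e2]
    refine mul_le_mul_of_nonneg_left ?_ (by positivity)
    calc η ^ 3 * w ^ 3 * (R - s ^ 2) ≤ η ^ 3 * w ^ 3 * (R * (1 - ε2)) := j1
      _ = η * w * (1 - ε2) * (η ^ 2 * w ^ 2 * R) := e3
      _ ≤ η * w * (1 - ε2) * (ε2 * u ^ 2 * s ^ 2) := j3
      _ ≤ η * u * (1 - ε2) * (ε2 * u ^ 2 * s ^ 2) := j4
      _ = η * ε2 * (1 - ε2) * (u ^ 3 * s ^ 2) := by ring
  -- conclusion: `≥ 8β³u³s² m ≥ 0`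
  have hmain : 8 * β ^ 3 * (u ^ 3 * s ^ 2) * ((2 * β - 1 - 2 * η) * (1 - η) ^ 2 - 2 * η * ε2 * (1 - ε2)) ≤
      (2 * β * (2 * β - 1) * u) * (2 * β * s * (u - η * w)) ^ 2 -
        2 * (2 * β * η * w) * ((2 * β * s * (u - η * w)) ^ 2 + 4 * β ^ 2 * η ^ 2 * w ^ 2 * (R - s ^ 2)) := by
    have e : (2 * β * (2 * β - 1) * u) * (2 * β * s * (u - η * w)) ^ 2 -
        2 * (2 * β * η * w) * ((2 * β * s * (u - η * w)) ^ 2 + 4 * β ^ 2 * η ^ 2 * w ^ 2 * (R - s ^ 2)) =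
        (2 * β * (2 * β - 1) * u - 2 * (2 * β * η * w)) * (2 * β * s * (u - η * w)) ^ 2 -
          2 * (2 * β * η * w) * (4 * β ^ 2 * η ^ 2 * w ^ 2 * (R - s ^ 2)) := by ring
    rw [e]
    nlinarith [hT1, hT2]
  have h0 : 0 ≤ 8 * β ^ 3 * (u ^ 3 * s ^ 2) *
      ((2 * β - 1 - 2 * η) * (1 - η) ^ 2 - 2 * η * ε2 * (1 - ε2)) :=
    mul_nonneg (by positivity) hm
  linarith [h0, hmain]

/-- **The `a²`-term** (paper, (4.13)–(4.15), in Seregin's `t`-weighted splitting with the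
gradient reserve `t|∇φ|²` subtracted): with `k = k₁(t) = (1-t)/t`, `|∇φ₀|² = gg`,
`f = 2βηw`, `φ₀ = us² - ηwR`,
`(4k - 2tk²) gg - 4k f φ₀ - 4t²k² f² ≥ k u²s² c₂`, `c₂ = 8β²(1-η)² - 8βη(1-η) - 4β²η²`
(`tk = 1 - t ≤ 1`, `4t²k² ≤ k`, `gg ≥ φ₀,₁² ≥ 4β²s²u²(1-η)²`, `φ₀ ≤ (1-η)us²`, `f ≤ 2βηu`). [cite: LiSverak2012, §4 (4.13)–(4.15)] -/
theorem cone_quadratic_bound {β η t k s R u w : ℝ} (hβ : 0 ≤ β) (hη0 : 0 ≤ η) (hη1 : η ≤ 1)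
    (ht0 : 0 < t) (ht1 : t < 1) (hk : t * k = 1 - t) (hs : 1 ≤ s) (hu : 0 ≤ u) (hw : 0 ≤ w)
    (hwu : w ≤ u) (hsR : s ^ 2 ≤ R) (h5 : η * w * R ≤ u * s ^ 2) (h6 : u * s ^ 2 ≤ w * R) :
    k * (u ^ 2 * s ^ 2) * (8 * β ^ 2 * (1 - η) ^ 2 - 8 * β * η * (1 - η) - 4 * β ^ 2 * η ^ 2) ≤
      (4 * k - 2 * t * k ^ 2) *
          ((2 * β * (u * s)) ^ 2 - 2 * (2 * β * (u * s)) * (2 * β * η * w) * s + (2 * β * η * w) ^ 2 * R) -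
        4 * k * (2 * β * η * w) * (u * s ^ 2 - η * (w * R)) -
        4 * t ^ 2 * k ^ 2 * (2 * β * η * w) ^ 2 := by
  have hkv : k = (1 - t) / t := by
    field_simp
    linarith [hk]
  have hk0 : 0 < k := by rw [hkv]; exact div_pos (by linarith) ht0
  -- `gg ≥ g₁² ≥ 4β²s²u²(1-η)²`
  have hD1 : u * (1 - η) ≤ u - η * w := by nlinarith
  have hD0 : 0 ≤ u * (1 - η) := mul_nonneg hu (by linarith)
  have hDsq : (u * (1 - η)) ^ 2 ≤ (u - η * w) ^ 2 := pow_le_pow_left₀ hD0 hD1 2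
  have hgg : 4 * β ^ 2 * s ^ 2 * (u * (1 - η)) ^ 2 ≤
      (2 * β * (u * s)) ^ 2 - 2 * (2 * β * (u * s)) * (2 * β * η * w) * s + (2 * β * η * w) ^ 2 * R := by
    have e : (2 * β * (u * s)) ^ 2 - 2 * (2 * β * (u * s)) * (2 * β * η * w) * s + (2 * β * η * w) ^ 2 * R =
        4 * β ^ 2 * s ^ 2 * (u - η * w) ^ 2 + 4 * β ^ 2 * η ^ 2 * w ^ 2 * (R - s ^ 2) := by ring
    rw [e]
    have h1 : 4 * β ^ 2 * s ^ 2 * (u * (1 - η)) ^ 2 ≤ 4 * β ^ 2 * s ^ 2 * (u - η * w) ^ 2 :=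
      mul_le_mul_of_nonneg_left hDsq (by positivity)
    have h2 : 0 ≤ 4 * β ^ 2 * η ^ 2 * w ^ 2 * (R - s ^ 2) := by
      have : 0 ≤ R - s ^ 2 := by linarith
      positivity
    linarith
  have hgg0 : 0 ≤ (2 * β * (u * s)) ^ 2 - 2 * (2 * β * (u * s)) * (2 * β * η * w) * s +
      (2 * β * η * w) ^ 2 * R := le_trans (by positivity) hgg
  -- the coefficient `4k - 2tk² = 2k + 2kt ≥ 2k`
  have hcoef : 2 * k ≤ 4 * k - 2 * t * k ^ 2 := by
    have e : 4 * k - 2 * t * k ^ 2 = 2 * k + 2 * (k * t) := by linear_combination (-2 * k) * hk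
    rw [e]
    nlinarith [mul_pos hk0 ht0]
  have hA : 2 * k * (4 * β ^ 2 * s ^ 2 * (u * (1 - η)) ^ 2) ≤ (4 * k - 2 * t * k ^ 2) *
      ((2 * β * (u * s)) ^ 2 - 2 * (2 * β * (u * s)) * (2 * β * η * w) * s + (2 * β * η * w) ^ 2 * R) :=
    mul_le_mul hcoef hgg (by positivity) (le_trans (by positivity) hcoef)
  -- `f φ₀ ≤ 2βηu · (1-η)us²`
  have hφ1 : u * s ^ 2 - η * (w * R) ≤ u * s ^ 2 * (1 - η) := by nlinarith [mul_le_mul_of_nonneg_left h6 hη0]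
  have hφ0 : 0 ≤ u * s ^ 2 - η * (w * R) := by linarith
  have hB : 4 * k * (2 * β * η * w) * (u * s ^ 2 - η * (w * R)) ≤
      4 * k * (2 * β * η * u) * (u * s ^ 2 * (1 - η)) := by
    have h1 : 4 * k * (2 * β * η * w) ≤ 4 * k * (2 * β * η * u) := by
      have : 2 * β * η * w ≤ 2 * β * η * u := mul_le_mul_of_nonneg_left hwu (by positivity)
      exact mul_le_mul_of_nonneg_left this (by positivity)
    exact mul_le_mul h1 hφ1 hφ0 (by positivity)
  -- `4t²k² f² ≤ k f² ≤ k · 4β²η²u²s²`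
  have h4k : 4 * t ^ 2 * k ^ 2 ≤ k := by
    have e : 4 * t ^ 2 * k ^ 2 = 4 * (1 - t) ^ 2 := by rw [← hk]; ring
    rw [e, hkv, le_div_iff₀ ht0]
    nlinarith [mul_nonneg (sub_nonneg.2 ht1.le) (sq_nonneg (2 * t - 1))]
  have hC : 4 * t ^ 2 * k ^ 2 * (2 * β * η * w) ^ 2 ≤ k * (4 * β ^ 2 * η ^ 2 * (u ^ 2 * s ^ 2)) := by
    have h1 : (2 * β * η * w) ^ 2 ≤ 4 * β ^ 2 * η ^ 2 * (u ^ 2 * s ^ 2) := by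
      have hw2 : w ^ 2 ≤ u ^ 2 := pow_le_pow_left₀ hw hwu 2
      have hs2 : u ^ 2 ≤ u ^ 2 * s ^ 2 := by nlinarith [pow_le_pow_left₀ zero_le_one hs 2, sq_nonneg u]
      nlinarith [mul_nonneg (mul_nonneg (sq_nonneg β) (sq_nonneg η)) (sub_nonneg.2 (hw2.trans hs2))]
    exact mul_le_mul h4k h1 (by positivity) hk0.le
  -- assembly (an identity between the three lower bounds and the claim)
  have e : k * (u ^ 2 * s ^ 2) * (8 * β ^ 2 * (1 - η) ^ 2 - 8 * β * η * (1 - η) - 4 * β ^ 2 * η ^ 2) =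
      2 * k * (4 * β ^ 2 * s ^ 2 * (u * (1 - η)) ^ 2) - 4 * k * (2 * β * η * u) * (u * s ^ 2 * (1 - η)) -
        k * (4 * β ^ 2 * η ^ 2 * (u ^ 2 * s ^ 2)) := by ring
  rw [e]
  linarith [hA, hB, hC]

/-- **The `a¹`-junk** (paper, (4.16)–(4.17): "the terms of homogeneity less than `α - 2`"):
all of `-t²k Δ²(x₁^α)`, `+t²kη Δ²-part of |x|^α`, `-t ΔG/a` carry a factor `(1 - β)` and are
bounded by `(1-β) · 9(d+4)² · k u` for `t ≤ 1 ≤ s`, `R ≥ 1`, `0 ≤ w ≤ u`, `η ≤ 1`, `1/2 ≤ β ≤ 1`. [cite: LiSverak2012, §4 (4.16)–(4.17)] -/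
theorem cone_linear_junk_bound {β η d t k s R u w : ℝ} (hβ : 1 / 2 ≤ β) (hβ1 : β ≤ 1)
    (hη0 : 0 ≤ η) (hη1 : η ≤ 1) (hd : 0 ≤ d) (ht0 : 0 ≤ t) (ht1 : t ≤ 1) (hk0 : 0 ≤ k)
    (hs : 1 ≤ s) (hR1 : 1 ≤ R) (hu : 0 ≤ u) (hw : 0 ≤ w) (hwu : w ≤ u) :
    |t ^ 2 * k * (2 * β * (2 * β - 1) * (2 * β - 2) * (2 * β - 3) * (u / s ^ 2))| +
      |t ^ 2 * k * (η * (2 * β * (d + 2 * β - 2) * (2 * (β - 1) * (d + 2 * (β - 1) - 2)) * (w / R)))| +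
      |t * (2 * (β - 1) * (d + 2 * (β - 1) - 2) * (4 * β * η * (t * k)) * (w / R))| ≤
      (1 - β) * (9 * (d + 4) ^ 2) * (k * u) := by
  have hs0 : 0 < s := by linarith
  have hR0 : 0 < R := by linarith
  have hus : u / s ^ 2 ≤ u := by
    rw [div_le_iff₀ (by positivity)]
    nlinarith [pow_le_pow_left₀ zero_le_one hs 2]
  have hwR : w / R ≤ u := by
    rw [div_le_iff₀ hR0]
    nlinarith
  have hus0 : 0 ≤ u / s ^ 2 := by positivity
  have hwR0 : 0 ≤ w / R := by positivity
  have ht2 : t ^ 2 ≤ 1 := by nlinarith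
  have hβ0 : 0 ≤ β := by linarith
  -- term 1: `|t²k · 2β(2β-1)(2β-2)(2β-3) u/s²| ≤ (1-β) · 8 · k u`
  have h1 : |t ^ 2 * k * (2 * β * (2 * β - 1) * (2 * β - 2) * (2 * β - 3) * (u / s ^ 2))| ≤
      (1 - β) * 8 * (k * u) := by
    rw [abs_le]
    have hP : 0 ≤ 2 * β * (2 * β - 1) * (2 * β - 2) * (2 * β - 3) := by
      have : 0 ≤ (2 * β - 2) * (2 * β - 3) := by nlinarith
      have h' : 2 * β * (2 * β - 1) * (2 * β - 2) * (2 * β - 3) = (2 * β * (2 * β - 1)) * ((2 * β - 2) * (2 * β - 3)) := by ring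
      rw [h']
      exact mul_nonneg (by nlinarith) this
    have hPle : 2 * β * (2 * β - 1) * (2 * β - 2) * (2 * β - 3) ≤ (1 - β) * 8 := by
      have e' : 2 * β * (2 * β - 1) * (2 * β - 2) * (2 * β - 3) =
          (1 - β) * (4 * (β * (2 * β - 1)) * (3 - 2 * β)) := by ring
      rw [e']
      refine mul_le_mul_of_nonneg_left ?_ (by linarith)
      have hb1 : β * (2 * β - 1) ≤ 1 := by
        have := mul_le_mul hβ1 (by linarith : 2 * β - 1 ≤ 1) (by linarith : 0 ≤ 2 * β - 1) zero_le_one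
        linarith
      have hb0 : 0 ≤ β * (2 * β - 1) := mul_nonneg hβ0 (by linarith)
      have := mul_le_mul hb1 (by linarith : 3 - 2 * β ≤ 2) (by linarith : 0 ≤ 3 - 2 * β) zero_le_one
      linarith
    have hX : t ^ 2 * k * (2 * β * (2 * β - 1) * (2 * β - 2) * (2 * β - 3) * (u / s ^ 2)) ≤
        (1 - β) * 8 * (k * u) := by
      calc t ^ 2 * k * (2 * β * (2 * β - 1) * (2 * β - 2) * (2 * β - 3) * (u / s ^ 2))
          ≤ 1 * k * ((1 - β) * 8 * u) := by
            apply mul_le_mul (mul_le_mul_of_nonneg_right ht2 hk0)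
              (mul_le_mul hPle hus hus0 (mul_nonneg (by linarith) (by norm_num)))
              (mul_nonneg hP hus0) (by positivity)
        _ = (1 - β) * 8 * (k * u) := by ring
    have hX0 : 0 ≤ t ^ 2 * k * (2 * β * (2 * β - 1) * (2 * β - 2) * (2 * β - 3) * (u / s ^ 2)) := by
      positivity
    have hnn : 0 ≤ (1 - β) * 8 * (k * u) := mul_nonneg (mul_nonneg (by linarith) (by norm_num)) (by positivity)
    constructor <;> linarith
  -- the dimension-dependent factors
  have hX : |d + 2 * β - 2| ≤ d + 4 := by rw [abs_le]; constructor <;> linarith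
  have hY : |d + 2 * (β - 1) - 2| ≤ d + 4 := by rw [abs_le]; constructor <;> linarith
  have hXY : |(d + 2 * β - 2) * (d + 2 * (β - 1) - 2)| ≤ (d + 4) ^ 2 := by
    rw [abs_mul, sq]
    exact mul_le_mul hX hY (abs_nonneg _) (by linarith)
  have htk : t ^ 2 * k * (w / R) ≤ k * u := by
    calc t ^ 2 * k * (w / R) ≤ 1 * k * u :=
          mul_le_mul (mul_le_mul_of_nonneg_right ht2 hk0) hwR hwR0 (by positivity)
      _ = k * u := by ring
  have htk0 : 0 ≤ t ^ 2 * k * (w / R) := by positivity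
  -- term 2: `|t²k η 2β(d+2β-2) 2(β-1)(d+2β-4) w/R| ≤ (1-β) 4(d+4)² k u`
  have h2 : |t ^ 2 * k * (η * (2 * β * (d + 2 * β - 2) * (2 * (β - 1) * (d + 2 * (β - 1) - 2)) * (w / R)))| ≤
      (1 - β) * (4 * (d + 4) ^ 2) * (k * u) := by
    have e' : t ^ 2 * k * (η * (2 * β * (d + 2 * β - 2) * (2 * (β - 1) * (d + 2 * (β - 1) - 2)) * (w / R))) =
        (1 - β) * ((-(4 * β * η)) * (((d + 2 * β - 2) * (d + 2 * (β - 1) - 2)) * (t ^ 2 * k * (w / R)))) := by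
      ring
    rw [e', abs_mul, abs_of_nonneg (by linarith : (0 : ℝ) ≤ 1 - β), abs_mul, abs_mul,
      abs_of_nonneg htk0]
    have hc : |(-(4 * β * η))| ≤ 4 := by
      rw [abs_neg, abs_of_nonneg (by positivity)]
      nlinarith [mul_le_mul hβ1 hη1 hη0 zero_le_one]
    have hin : |(-(4 * β * η))| * (|(d + 2 * β - 2) * (d + 2 * (β - 1) - 2)| * (t ^ 2 * k * (w / R))) ≤
        4 * ((d + 4) ^ 2 * (k * u)) :=
      mul_le_mul hc (mul_le_mul hXY htk htk0 (by positivity)) (by positivity) (by norm_num)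
    calc (1 - β) * (|(-(4 * β * η))| * (|(d + 2 * β - 2) * (d + 2 * (β - 1) - 2)| * (t ^ 2 * k * (w / R))))
        ≤ (1 - β) * (4 * ((d + 4) ^ 2 * (k * u))) := mul_le_mul_of_nonneg_left hin (by linarith)
      _ = (1 - β) * (4 * (d + 4) ^ 2) * (k * u) := by ring
  -- term 3: `|t · 2(β-1)(d+2β-6) 4βη (tk) w/R| ≤ (1-β) 4(d+4)² k u`
  have h3 : |t * (2 * (β - 1) * (d + 2 * (β - 1) - 2) * (4 * β * η * (t * k)) * (w / R))| ≤
      (1 - β) * (4 * (d + 4) ^ 2) * (k * u) := by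
    have e' : t * (2 * (β - 1) * (d + 2 * (β - 1) - 2) * (4 * β * η * (t * k)) * (w / R)) =
        (1 - β) * ((-(8 * β * η)) * ((d + 2 * (β - 1) - 2) * (t ^ 2 * k * (w / R)))) := by ring
    rw [e', abs_mul, abs_of_nonneg (by linarith : (0 : ℝ) ≤ 1 - β), abs_mul, abs_mul, abs_of_nonneg htk0]
    have hc : |(-(8 * β * η))| ≤ 8 := by
      rw [abs_neg, abs_of_nonneg (by positivity)]
      nlinarith [mul_le_mul hβ1 hη1 hη0 zero_le_one]
    have hY' : |d + 2 * (β - 1) - 2| ≤ (d + 4) ^ 2 / 2 := by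
      refine hY.trans ?_
      rw [le_div_iff₀ (by norm_num : (0 : ℝ) < 2)]
      nlinarith
    have hin : |(-(8 * β * η))| * (|d + 2 * (β - 1) - 2| * (t ^ 2 * k * (w / R))) ≤
        8 * ((d + 4) ^ 2 / 2 * (k * u)) :=
      mul_le_mul hc (mul_le_mul hY' htk htk0 (by positivity)) (by positivity) (by norm_num)
    calc (1 - β) * (|(-(8 * β * η))| * (|d + 2 * (β - 1) - 2| * (t ^ 2 * k * (w / R))))
        ≤ (1 - β) * (8 * ((d + 4) ^ 2 / 2 * (k * u))) := mul_le_mul_of_nonneg_left hin (by linarith)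
      _ = (1 - β) * (4 * (d + 4) ^ 2) * (k * u) := by ring
  have h8 : (1 - β) * 8 * (k * u) ≤ (1 - β) * ((d + 4) ^ 2) * (k * u) := by
    have h8' : (8 : ℝ) ≤ (d + 4) ^ 2 := by nlinarith
    have hku : 0 ≤ (1 - β) * (k * u) := mul_nonneg (by linarith) (by positivity)
    have := mul_le_mul_of_nonneg_right h8' hku
    linarith
  linarith [h1, h2, h3, h8]

set_option maxHeartbeats 3200000 in
/-- **The pointwise lower bound of the zeroth-order weight, in atoms** (paper, §4, (4.8)–(4.18)
combined): the zeroth-order coefficient `M` of `|v|²` produced by Seregin's commutator identity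
(A.1.6) plus the multiplier terms, minus the gradient reserve `t|∇φ|²`, dominates
`(c₂/2) a² k₁ + a φ₀` once `a c₂ ≥ 2(1-β)·9(d+4)²`. Everything is written in the atoms of
`cone_cubic_nonneg`/`cone_quadratic_bound` (`k = k₁(t)`, `k₁' = -1/t²`, `k₁'' = 2/t³`;
`gg = |∇φ₀|²`, `g1 = φ₀,₁`, `φ0 = φ₀`). [cite: LiSverak2012, §4 (4.8)–(4.18)] -/
theorem cone_pointwise_core {a β η ε2 d t k s R u w gg g1 φ0 : ℝ} (hβ : 1 / 2 ≤ β) (hβ1 : β ≤ 1)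
    (hη0 : 0 ≤ η) (hη1 : η ≤ 1) (hε1 : ε2 ≤ 1) (hd : 0 ≤ d) (ht0 : 0 < t) (ht1 : t < 1)
    (hk : t * k = 1 - t) (hs : 1 ≤ s) (hsR : s ^ 2 ≤ R) (hu : 0 ≤ u) (hw : 0 ≤ w) (hwu : w ≤ u)
    (hus : 1 ≤ u * s) (hR : ε2 * R ≤ s ^ 2) (h3 : η ^ 2 * w ^ 2 * R ≤ ε2 * u ^ 2 * s ^ 2)
    (h5 : η * w * R ≤ u * s ^ 2) (h6 : u * s ^ 2 ≤ w * R) (hκ : 0 ≤ 2 * β - 1 - 2 * η)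
    (hm : 0 ≤ (2 * β - 1 - 2 * η) * (1 - η) ^ 2 - 2 * η * ε2 * (1 - ε2))
    (hc₂ : 0 < 8 * β ^ 2 * (1 - η) ^ 2 - 8 * β * η * (1 - η) - 4 * β ^ 2 * η ^ 2) (ha0 : 0 ≤ a)
    (ha : 2 * ((1 - β) * (9 * (d + 4) ^ 2)) ≤ a * (8 * β ^ 2 * (1 - η) ^ 2 - 8 * β * η * (1 - η) - 4 * β ^ 2 * η ^ 2))
    (hgg : gg = (2 * β * (u * s)) ^ 2 - 2 * (2 * β * (u * s)) * (2 * β * η * w) * s + (2 * β * η * w) ^ 2 * R)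
    (hg1 : g1 = 2 * β * (u * s) - 2 * β * η * w * s) (hφ0 : φ0 = u * s ^ 2 - η * (w * R)) :
    (8 * β ^ 2 * (1 - η) ^ 2 - 8 * β * η * (1 - η) - 4 * β ^ 2 * η ^ 2) / 2 * a ^ 2 * k + a * φ0 +
        t * ((a * k) ^ 2 * gg) ≤
      4 * t ^ 2 * (a * k * (2 * β * (2 * β - 1) * u * (a * k * g1) ^ 2 -
          η * (2 * β * w * ((a * k) ^ 2 * gg) + 4 * β * (β - 1) * (w / R) * (a * k * (2 * β * φ0)) ^ 2))) +
        t ^ 2 * ((2 + a * (2 / t ^ 3) * φ0) - 2 * (2 * (a * k) * (a * (-1 / t ^ 2)) * gg) -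
          a * k * (2 * β * (2 * β - 1) * (2 * β - 2) * (2 * β - 3) * (u / s ^ 2) -
            η * (2 * β * (d + 2 * β - 2) * (2 * (β - 1) * (d + 2 * (β - 1) - 2)) * (w / R)))) -
        t * ((a * k) ^ 2 * gg - (2 * t + a * (-1 / t ^ 2) * φ0)) -
        t * (2 * (β - 1) * (d + 2 * (β - 1) - 2) * (4 * a * β * η * (t * k)) * (w / R)) -
        2 * t * (2 * t * (a * k) * (2 * β * η * w)) * ((a * k) ^ 2 * gg - (2 * t + a * (-1 / t ^ 2) * φ0)) +
        2 * t * (a * k) * (2 * β * η * w) - (2 * t * (a * k) * (2 * β * η * w)) ^ 2 := by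
  have hβ0 : 0 ≤ β := by linarith
  have ht1' : t ≤ 1 := ht1.le
  have hs0 : 0 < s := by linarith
  have hR0 : 0 < R := by nlinarith
  have hR1 : 1 ≤ R := by nlinarith
  have hkv : k = (1 - t) / t := by field_simp; linarith [hk]
  have hk0 : 0 < k := by rw [hkv]; exact div_pos (by linarith) ht0
  have hφ0nn : 0 ≤ φ0 := by rw [hφ0]; linarith
  have hus2 : 1 ≤ u * s ^ 2 := by
    have h := mul_le_mul hus hs zero_le_one (zero_le_one.trans hus)
    have e : u * s * s = u * s ^ 2 := by ring
    rw [one_mul, e] at h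
    exact h
  have hwR0 : 0 ≤ w / R := div_nonneg hw hR0.le
  have hc₂0 : 0 ≤ (8 * β ^ 2 * (1 - η) ^ 2 - 8 * β * η * (1 - η) - 4 * β ^ 2 * η ^ 2) / 2 := by linarith
  -- ### the three orders
  have hQ3 : 0 ≤ 2 * β * (2 * β - 1) * u * g1 ^ 2 - 2 * (2 * β * η * w) * gg -
      4 * β * η * (β - 1) * (w / R) * (2 * β * φ0) ^ 2 := by
    have hcub := cone_cubic_nonneg (s := s) (R := R) hβ0 hη0 hη1 hε1 hR0.le hu hw hwu hR h3 hκ hm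
    have e1 : 2 * β * (2 * β - 1) * u * g1 ^ 2 - 2 * (2 * β * η * w) * gg =
        (2 * β * (2 * β - 1) * u) * (2 * β * s * (u - η * w)) ^ 2 -
          2 * (2 * β * η * w) * ((2 * β * s * (u - η * w)) ^ 2 + 4 * β ^ 2 * η ^ 2 * w ^ 2 * (R - s ^ 2)) := by
      rw [hg1, hgg]; ring
    have e2 : 0 ≤ -(4 * β * η * (β - 1) * (w / R) * (2 * β * φ0) ^ 2) := by
      have : 0 ≤ 4 * β * η * (1 - β) * (w / R) * (2 * β * φ0) ^ 2 :=
        mul_nonneg (mul_nonneg (mul_nonneg (mul_nonneg (by linarith) hη0) (by linarith)) hwR0) (sq_nonneg _)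
      linarith
    linarith [hcub, e1, e2]
  have hX2 : k * (u ^ 2 * s ^ 2) * (8 * β ^ 2 * (1 - η) ^ 2 - 8 * β * η * (1 - η) - 4 * β ^ 2 * η ^ 2) ≤
      (4 * k - 2 * t * k ^ 2) * gg - 4 * k * (2 * β * η * w) * φ0 - 4 * t ^ 2 * k ^ 2 * (2 * β * η * w) ^ 2 := by
    rw [hgg, hφ0]
    exact cone_quadratic_bound hβ0 hη0 hη1 ht0 ht1 hk hs hu hw hwu hsR h5 h6
  have hJ := cone_linear_junk_bound (η := η) (d := d) (s := s) (R := R) (u := u) (w := w) hβ hβ1 hη0 hη1 hd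
    ht0.le ht1' hk0.le hs hR1 hu hw hwu
  -- the junk without absolute values
  have hJ' : t ^ 2 * k * (2 * β * (2 * β - 1) * (2 * β - 2) * (2 * β - 3) * (u / s ^ 2)) -
      t ^ 2 * k * (η * (2 * β * (d + 2 * β - 2) * (2 * (β - 1) * (d + 2 * (β - 1) - 2)) * (w / R))) +
      t * (2 * (β - 1) * (d + 2 * (β - 1) - 2) * (4 * β * η * (t * k)) * (w / R)) ≤
      (1 - β) * (9 * (d + 4) ^ 2) * (k * u) := by
    have a1 := le_abs_self (t ^ 2 * k * (2 * β * (2 * β - 1) * (2 * β - 2) * (2 * β - 3) * (u / s ^ 2)))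
    have a2 := neg_abs_le (t ^ 2 * k * (η * (2 * β * (d + 2 * β - 2) * (2 * (β - 1) * (d + 2 * (β - 1) - 2)) * (w / R))))
    have a3 := le_abs_self (t * (2 * (β - 1) * (d + 2 * (β - 1) - 2) * (4 * β * η * (t * k)) * (w / R)))
    linarith
  -- ### auxiliary nonnegative quantities
  have hA1 : 0 ≤ (8 * β ^ 2 * (1 - η) ^ 2 - 8 * β * η * (1 - η) - 4 * β ^ 2 * η ^ 2) / 2 * a ^ 2 * k *
      (u ^ 2 * s ^ 2 - 1) := by
    have h1 : 0 ≤ u ^ 2 * s ^ 2 - 1 := by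
      have e : u ^ 2 * s ^ 2 - 1 = (u * s - 1) * (u * s + 1) := by ring
      rw [e]
      exact mul_nonneg (by linarith) (by linarith)
    exact mul_nonneg (mul_nonneg (mul_nonneg hc₂0 (sq_nonneg a)) hk0.le) h1
  have hA2 : 0 ≤ (8 * β ^ 2 * (1 - η) ^ 2 - 8 * β * η * (1 - η) - 4 * β ^ 2 * η ^ 2) / 2 * a ^ 2 * k *
      (u ^ 2 * s ^ 2) - a * ((1 - β) * (9 * (d + 4) ^ 2) * (k * u)) := by
    have e : (8 * β ^ 2 * (1 - η) ^ 2 - 8 * β * η * (1 - η) - 4 * β ^ 2 * η ^ 2) / 2 * a ^ 2 * k *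
        (u ^ 2 * s ^ 2) - a * ((1 - β) * (9 * (d + 4) ^ 2) * (k * u)) =
        a * k * u * ((a * (8 * β ^ 2 * (1 - η) ^ 2 - 8 * β * η * (1 - η) - 4 * β ^ 2 * η ^ 2)) / 2 *
          (u * s ^ 2) - (1 - β) * (9 * (d + 4) ^ 2)) := by ring
    rw [e]
    refine mul_nonneg (mul_nonneg (mul_nonneg ha0 hk0.le) hu) ?_
    have h0 : 0 ≤ a * (8 * β ^ 2 * (1 - η) ^ 2 - 8 * β * η * (1 - η) - 4 * β ^ 2 * η ^ 2) / 2 := by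
      have := mul_nonneg ha0 hc₂.le
      linarith
    have h2 := mul_le_mul_of_nonneg_left hus2 h0
    linarith
  have hA3 : 0 ≤ a * φ0 * (1 / t - 1) := by
    have h1 : 0 ≤ 1 / t - 1 := by rw [sub_nonneg, le_div_iff₀ ht0]; linarith
    exact mul_nonneg (mul_nonneg ha0 hφ0nn) h1
  have hG0 : 0 ≤ 2 * t * (a * k) * (2 * β * η * w) :=
    mul_nonneg (mul_nonneg (by linarith) (mul_nonneg ha0 hk0.le)) (mul_nonneg (mul_nonneg (by linarith) hη0) hw)
  have hA4 : 0 ≤ (4 * t ^ 2 + 1) * (2 * t * (a * k) * (2 * β * η * w)) := mul_nonneg (by positivity) hG0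
  have hA5 : 0 ≤ 4 * t ^ 2 * k ^ 3 * a ^ 3 :=
    mul_nonneg (mul_nonneg (by positivity) (pow_nonneg hk0.le 3)) (pow_nonneg ha0 3)
  have hA6 := mul_nonneg hA5 hQ3
  have hB2 : 0 ≤ a ^ 2 * ((4 * k - 2 * t * k ^ 2) * gg - 4 * k * (2 * β * η * w) * φ0 -
      4 * t ^ 2 * k ^ 2 * (2 * β * η * w) ^ 2 -
      k * (u ^ 2 * s ^ 2) * (8 * β ^ 2 * (1 - η) ^ 2 - 8 * β * η * (1 - η) - 4 * β ^ 2 * η ^ 2)) :=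
    mul_nonneg (sq_nonneg a) (by linarith)
  have hB1 : 0 ≤ a * ((1 - β) * (9 * (d + 4) ^ 2) * (k * u) -
      (t ^ 2 * k * (2 * β * (2 * β - 1) * (2 * β - 2) * (2 * β - 3) * (u / s ^ 2)) -
        t ^ 2 * k * (η * (2 * β * (d + 2 * β - 2) * (2 * (β - 1) * (d + 2 * (β - 1) - 2)) * (w / R))) +
        t * (2 * (β - 1) * (d + 2 * (β - 1) - 2) * (4 * β * η * (t * k)) * (w / R)))) :=
    mul_nonneg ha0 (by linarith)
  have h4t : 0 ≤ 4 * t ^ 2 := by positivity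
  -- ### the algebraic identity
  have ht : t ≠ 0 := ht0.ne'
  have key : 4 * t ^ 2 * (a * k * (2 * β * (2 * β - 1) * u * (a * k * g1) ^ 2 -
          η * (2 * β * w * ((a * k) ^ 2 * gg) + 4 * β * (β - 1) * (w / R) * (a * k * (2 * β * φ0)) ^ 2))) +
        t ^ 2 * ((2 + a * (2 / t ^ 3) * φ0) - 2 * (2 * (a * k) * (a * (-1 / t ^ 2)) * gg) -
          a * k * (2 * β * (2 * β - 1) * (2 * β - 2) * (2 * β - 3) * (u / s ^ 2) -
            η * (2 * β * (d + 2 * β - 2) * (2 * (β - 1) * (d + 2 * (β - 1) - 2)) * (w / R)))) -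
        t * ((a * k) ^ 2 * gg - (2 * t + a * (-1 / t ^ 2) * φ0)) -
        t * (2 * (β - 1) * (d + 2 * (β - 1) - 2) * (4 * a * β * η * (t * k)) * (w / R)) -
        2 * t * (2 * t * (a * k) * (2 * β * η * w)) * ((a * k) ^ 2 * gg - (2 * t + a * (-1 / t ^ 2) * φ0)) +
        2 * t * (a * k) * (2 * β * η * w) - (2 * t * (a * k) * (2 * β * η * w)) ^ 2 -
        ((8 * β ^ 2 * (1 - η) ^ 2 - 8 * β * η * (1 - η) - 4 * β ^ 2 * η ^ 2) / 2 * a ^ 2 * k + a * φ0 +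
          t * ((a * k) ^ 2 * gg)) =
      4 * t ^ 2 * k ^ 3 * a ^ 3 * (2 * β * (2 * β - 1) * u * g1 ^ 2 - 2 * (2 * β * η * w) * gg -
          4 * β * η * (β - 1) * (w / R) * (2 * β * φ0) ^ 2) +
        a ^ 2 * ((4 * k - 2 * t * k ^ 2) * gg - 4 * k * (2 * β * η * w) * φ0 -
          4 * t ^ 2 * k ^ 2 * (2 * β * η * w) ^ 2 -
          k * (u ^ 2 * s ^ 2) * (8 * β ^ 2 * (1 - η) ^ 2 - 8 * β * η * (1 - η) - 4 * β ^ 2 * η ^ 2)) +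
        (8 * β ^ 2 * (1 - η) ^ 2 - 8 * β * η * (1 - η) - 4 * β ^ 2 * η ^ 2) / 2 * a ^ 2 * k *
          (u ^ 2 * s ^ 2 - 1) +
        ((8 * β ^ 2 * (1 - η) ^ 2 - 8 * β * η * (1 - η) - 4 * β ^ 2 * η ^ 2) / 2 * a ^ 2 * k *
          (u ^ 2 * s ^ 2) - a * ((1 - β) * (9 * (d + 4) ^ 2) * (k * u))) +
        a * ((1 - β) * (9 * (d + 4) ^ 2) * (k * u) -
          (t ^ 2 * k * (2 * β * (2 * β - 1) * (2 * β - 2) * (2 * β - 3) * (u / s ^ 2)) -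
            t ^ 2 * k * (η * (2 * β * (d + 2 * β - 2) * (2 * (β - 1) * (d + 2 * (β - 1) - 2)) * (w / R))) +
            t * (2 * (β - 1) * (d + 2 * (β - 1) - 2) * (4 * β * η * (t * k)) * (w / R)))) +
        a * φ0 * (1 / t - 1) + (4 * t ^ 2 + 1) * (2 * t * (a * k) * (2 * β * η * w)) + 4 * t ^ 2 := by
    field_simp
    ring
  have hfin := sub_nonneg.1 (by
    rw [key]
    linarith [hA6, hB2, hA1, hA2, hB1, hA3, hA4, h4t])
  linarith [hfin]

end ConePointwise

/-! ### From the frame objects to the atoms -/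

section ConeAtoms

/-- Powers of `s > 0`: `s^{2β-1} = s^{2β-2} s`, `s^{2β} = s^{2β-2} s²`, `s^{2β-4} = s^{2β-2}/s²`. [folklore] -/
theorem rpow_atoms_s {s : ℝ} (hs : 0 < s) (β : ℝ) :
    s ^ (2 * β - 1) = s ^ (2 * β - 2) * s ∧ s ^ (2 * β) = s ^ (2 * β - 2) * s ^ 2 ∧
      s ^ (2 * β - 4) = s ^ (2 * β - 2) / s ^ 2 := by
  refine ⟨?_, ?_, ?_⟩
  · rw [show 2 * β - 1 = (2 * β - 2) + 1 by ring, Real.rpow_add_one hs.ne']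
  · have h := Real.rpow_add hs (2 * β - 2) 2
    rw [show 2 * β - 2 + 2 = 2 * β by ring, Real.rpow_two] at h
    exact h
  · rw [show 2 * β - 4 = (2 * β - 2) - 2 by ring, Real.rpow_sub hs, Real.rpow_two]

/-- Powers of `R > 0`: `R^β = R^{β-1} R`, `R^{β-2} = R^{β-1}/R`. [folklore] -/
theorem rpow_atoms_R {R : ℝ} (hR : 0 < R) (β : ℝ) :
    R ^ β = R ^ (β - 1) * R ∧ R ^ (β - 2) = R ^ (β - 1) / R := by
  refine ⟨?_, ?_⟩
  · rw [Real.rpow_sub_one hR.ne', div_mul_cancel₀ _ hR.ne']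
  · rw [show β - 2 = (β - 1) - 1 by ring, Real.rpow_sub_one hR.ne']

/-- **The monotonicity facts of the atoms on the truncated cone**: for reals `s ≥ 1`, `R ≥ s²`,
`0 ≤ ε`, `ε²R ≤ s²`, `1/2 < β ≤ 1`, with `η = ε^{2β}`, `u = s^{2β-2}`, `w = R^{β-1}`:
`w ≤ u`, `1 ≤ us`, `η²w²R ≤ ε²u²s²`, `ηwR ≤ us²`, `us² ≤ wR`, `0 ≤ η`
(`|x|^{α-2} ≤ x₁^{α-2}`, `x₁^{α-1} ≥ 1`, `(ε|x|)^{2α-2} ≤ x₁^{2α-2}`, `(ε|x|)^α ≤ x₁^α ≤ |x|^α`). [folklore] -/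
theorem cone_atom_facts {s R ε β : ℝ} (hs : 1 ≤ s) (hsR : s ^ 2 ≤ R) (hε0 : 0 ≤ ε)
    (hεR : ε ^ 2 * R ≤ s ^ 2) (hβ : 1 / 2 < β) (hβ1 : β ≤ 1) :
    R ^ (β - 1) ≤ s ^ (2 * β - 2) ∧ 1 ≤ s ^ (2 * β - 2) * s ∧
      (ε ^ (2 * β)) ^ 2 * (R ^ (β - 1)) ^ 2 * R ≤ ε ^ 2 * (s ^ (2 * β - 2)) ^ 2 * s ^ 2 ∧
      ε ^ (2 * β) * R ^ (β - 1) * R ≤ s ^ (2 * β - 2) * s ^ 2 ∧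
      s ^ (2 * β - 2) * s ^ 2 ≤ R ^ (β - 1) * R ∧ 0 ≤ ε ^ (2 * β) := by
  -- `(x²)^q = x^{2q}`, `(x^q)² = x^{2q}` (as in `CubicSieve.rpow_sq_eq`, not importable here)
  have sq_rpow_eq : ∀ {x : ℝ}, 0 ≤ x → ∀ q : ℝ, (x ^ 2) ^ q = x ^ (2 * q) := fun hx q => by
    rw [Real.rpow_mul hx, Real.rpow_two]
  have rpow_sq_eq : ∀ {x : ℝ}, 0 ≤ x → ∀ q : ℝ, (x ^ q) ^ 2 = x ^ (2 * q) := fun hx q => by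
    rw [← Real.rpow_two, ← Real.rpow_mul hx, mul_comm]
  have hs0 : 0 < s := by linarith
  have hR0 : 0 < R := by nlinarith
  have hη0 : 0 ≤ ε ^ (2 * β) := Real.rpow_nonneg hε0 _
  have hεR0 : 0 ≤ ε ^ 2 * R := by positivity
  obtain ⟨hP1, hP0, -⟩ := rpow_atoms_s hs0 β
  obtain ⟨hN0, -⟩ := rpow_atoms_R hR0 β
  -- `w ≤ u`
  have hwu : R ^ (β - 1) ≤ s ^ (2 * β - 2) := by
    rw [show 2 * β - 2 = 2 * (β - 1) by ring, ← sq_rpow_eq hs0.le]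
    exact Real.rpow_le_rpow_of_nonpos (by positivity) hsR (by linarith)
  -- `us ≥ 1`
  have hus : 1 ≤ s ^ (2 * β - 2) * s := by
    rw [← hP1]
    exact Real.one_le_rpow hs (by linarith)
  -- `(ε²R)^{2β-1} ≤ (s²)^{2β-1}`
  have hA : (ε ^ 2 * R) ^ (2 * β - 1) ≤ (s ^ 2) ^ (2 * β - 1) :=
    Real.rpow_le_rpow hεR0 hεR (by linarith)
  have h3 : (ε ^ (2 * β)) ^ 2 * (R ^ (β - 1)) ^ 2 * R ≤ ε ^ 2 * (s ^ (2 * β - 2)) ^ 2 * s ^ 2 := by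
    rw [Real.mul_rpow (by positivity) hR0.le, sq_rpow_eq hε0, sq_rpow_eq hs0.le] at hA
    have hA' := mul_le_mul_of_nonneg_left hA (sq_nonneg ε)
    have eL : (ε ^ (2 * β)) ^ 2 * (R ^ (β - 1)) ^ 2 * R = ε ^ 2 * (ε ^ (2 * (2 * β - 1)) * R ^ (2 * β - 1)) := by
      rw [rpow_sq_eq hε0, rpow_sq_eq hR0.le, mul_assoc, show 2 * (β - 1) = (2 * β - 1) - 1 by ring,
        Real.rpow_sub_one hR0.ne', div_mul_cancel₀ _ hR0.ne', show 2 * (2 * β) = 2 + 2 * (2 * β - 1) by ring,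
        Real.rpow_add' hε0 (by linarith : (2 : ℝ) + 2 * (2 * β - 1) ≠ 0), Real.rpow_two, mul_assoc]
    have eR : ε ^ 2 * (s ^ (2 * β - 2)) ^ 2 * s ^ 2 = ε ^ 2 * s ^ (2 * (2 * β - 1)) := by
      rw [rpow_sq_eq hs0.le, mul_assoc, ← Real.rpow_two s, ← Real.rpow_add hs0]
      congr 1; congr 1; ring
    rw [eL, eR]
    exact hA'
  -- `(ε²R)^β ≤ (s²)^β ≤ R^β`
  have hB : (ε ^ 2 * R) ^ β ≤ (s ^ 2) ^ β := Real.rpow_le_rpow hεR0 hεR (by linarith)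
  have hC : (s ^ 2) ^ β ≤ R ^ β := Real.rpow_le_rpow (by positivity) hsR (by linarith)
  have h5 : ε ^ (2 * β) * R ^ (β - 1) * R ≤ s ^ (2 * β - 2) * s ^ 2 := by
    rw [Real.mul_rpow (by positivity) hR0.le, sq_rpow_eq hε0, sq_rpow_eq hs0.le, hN0, hP0, ← mul_assoc] at hB
    exact hB
  have h6 : s ^ (2 * β - 2) * s ^ 2 ≤ R ^ (β - 1) * R := by
    rw [sq_rpow_eq hs0.le, hN0, hP0] at hC
    exact hC
  exact ⟨hwu, hus, h3, h5, h6, hη0⟩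

end ConeAtoms


section ConeLowerBound

variable {E : Type*} [NormedAddCommGroup E] [InnerProductSpace ℝ E] [FiniteDimensional ℝ E]

set_option maxHeartbeats 1600000 in
/-- **The zeroth-order weight of the cone Carleman inequality, lower bound** (paper, §4,
(4.8)–(4.18)): at a point `z = (t, x)` with `0 < t < 1`, `ε|x| ≤ ⟪x,e⟫`, `⟪x,e⟫ ≥ 1`, for
`η = ε^{2β}`, `1/2 < β ≤ 1`, `m(β, ε) ≥ 0`, `2β - 1 - 2η ≥ 0`, `c₂ > 0` and
`a c₂ ≥ 2(1-β)·9(d+4)²`, the coefficient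
`M = 4t²Σφᵢⱼφᵢφⱼ + t²(∂ₜ²φ - 2∂ₜ|∇φ|² - Δ²φ) - t q - tΔG - 2tGq + G - G²` (`q = |∇φ|² - ∂ₜφ`)
of `|v|²` satisfies `M ≥ (c₂/2)a²k₁(t) + aφ₀(x) + t|∇φ|²`. [cite: LiSverak2012, §4 (4.8)–(4.18)] -/
theorem cone_weight_lower_bound {e : E} (he : ‖e‖ = 1) {a β ε η : ℝ} (hβ : 1 / 2 < β) (hβ1 : β ≤ 1)
    (hε0 : 0 ≤ ε) (hη : η = ε ^ (2 * β)) (hκ : 0 ≤ 2 * β - 1 - 2 * η)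
    (hm : 0 ≤ (2 * β - 1 - 2 * η) * (1 - η) ^ 2 - 2 * η * ε ^ 2 * (1 - ε ^ 2))
    (hc₂ : 0 < 8 * β ^ 2 * (1 - η) ^ 2 - 8 * β * η * (1 - η) - 4 * β ^ 2 * η ^ 2) (ha0 : 0 ≤ a)
    (ha : 2 * ((1 - β) * (9 * ((Module.finrank ℝ E : ℝ) + 4) ^ 2)) ≤
      a * (8 * β ^ 2 * (1 - η) ^ 2 - 8 * β * η * (1 - η) - 4 * β ^ 2 * η ^ 2))
    {z : ℝ × E} (ht0 : 0 < z.1) (ht1 : z.1 < 1) (hcone : ε * ‖z.2‖ ≤ ⟪z.2, e⟫) (hs : 1 ≤ ⟪z.2, e⟫) :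
    (8 * β ^ 2 * (1 - η) ^ 2 - 8 * β * η * (1 - η) - 4 * β ^ 2 * η ^ 2) / 2 * a ^ 2 * kA 1 z.1 +
        a * conePhi0 β η e z.2 + z.1 * ‖gradX (conePhi a β η e) z‖ ^ 2 ≤
      4 * z.1 ^ 2 * (∑ i, ∑ j, dx (stdOrthonormalBasis ℝ E i) (dx (stdOrthonormalBasis ℝ E j) (conePhi a β η e)) z *
          dx (stdOrthonormalBasis ℝ E i) (conePhi a β η e) z * dx (stdOrthonormalBasis ℝ E j) (conePhi a β η e) z) +
        z.1 ^ 2 * (dt (dt (conePhi a β η e)) z - 2 * dt (fun y => ‖gradX (conePhi a β η e) y‖ ^ 2) z -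
          lap (lap (conePhi a β η e)) z) -
        z.1 * qW (conePhi a β η e) z - z.1 * lap (coneG a β η) z -
        2 * z.1 * coneG a β η z * qW (conePhi a β η e) z + coneG a β η z - coneG a β η z ^ 2 := by
  have hz : z ∈ halfDom e := ⟨ht0, by linarith⟩
  have hs0 : (0 : ℝ) < ⟪z.2, e⟫ := by linarith
  have hsx : ⟪z.2, e⟫ ≤ ‖z.2‖ := by
    have h := abs_real_inner_le_norm z.2 e
    rw [he, mul_one] at h
    exact le_trans (le_abs_self _) h
  have hx0 : 0 < ‖z.2‖ := lt_of_lt_of_le hs0 hsx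
  have hR0 : (0 : ℝ) < ‖z.2‖ ^ 2 := by positivity
  have hsR : ⟪z.2, e⟫ ^ 2 ≤ ‖z.2‖ ^ 2 := pow_le_pow_left₀ hs0.le hsx 2
  have hεR : ε ^ 2 * ‖z.2‖ ^ 2 ≤ ⟪z.2, e⟫ ^ 2 := by
    have h := pow_le_pow_left₀ (mul_nonneg hε0 (norm_nonneg _)) hcone 2
    rw [mul_pow] at h
    exact h
  have hε1 : ε ^ 2 ≤ 1 := by
    have h1 : ε ^ 2 * ‖z.2‖ ^ 2 ≤ 1 * ‖z.2‖ ^ 2 := by rw [one_mul]; exact hεR.trans hsR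
    exact le_of_mul_le_mul_right h1 hR0
  have hη1 : η ≤ 1 := by linarith
  have hk : z.1 * kA 1 z.1 = 1 - z.1 := by rw [kA_one_eq ht0]; field_simp
  have hd : (0 : ℝ) ≤ (Module.finrank ℝ E : ℝ) := Nat.cast_nonneg _
  obtain ⟨hwu, hus, h3, h5, h6, hη0⟩ := cone_atom_facts hs hsR hε0 hεR hβ hβ1
  rw [← hη] at h3 h5 hη0
  obtain ⟨hP1, hP0, hP4⟩ := rpow_atoms_s hs0 β
  obtain ⟨hN0, hN2⟩ := rpow_atoms_R hR0 β
  -- rewrite every piece in closed form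
  rw [sum_hess_conePhi_grad a β η e hz, dt_dt_conePhi a β η e hz, dt_norm_gradX_conePhi_sq a β η e hz,
    lap_lap_conePhi a β η he hz, qW, norm_gradX_conePhi_sq a β η e hz, dt_conePhi a β η e hz,
    lap_coneG a β η e hz, gradX_conePhi a β η e hz, real_inner_smul_left, real_inner_smul_left,
    inner_coneGrad_axis β η he, inner_coneGrad_self β η e hs0, norm_coneGrad_sq β η he,
    deriv_kA_one ht0, deriv2_kA_one ht0]
  simp only [coneG, conePhi0]
  rw [hP1, hP0, hP4, hN0, hN2]
  have core := cone_pointwise_core (a := a) (d := (Module.finrank ℝ E : ℝ)) (t := z.1) (k := kA 1 z.1)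
    (s := ⟪z.2, e⟫) (R := ‖z.2‖ ^ 2) (u := ⟪z.2, e⟫ ^ (2 * β - 2)) (w := (‖z.2‖ ^ 2) ^ (β - 1))
    hβ.le hβ1 hη0 hη1 hε1 hd ht0 ht1 hk hs hsR (Real.rpow_nonneg hs0.le _) (Real.rpow_nonneg hR0.le _)
    hwu hus hεR h3 h5 h6 hκ hm hc₂ ha0 ha rfl rfl rfl
  linarith [core]

end ConeLowerBound


/-! ### Green's formula with a general smooth multiplier -/

section GreenMultiplier

variable {E : Type*} [NormedAddCommGroup E] [InnerProductSpace ℝ E] [FiniteDimensional ℝ E]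
  [MeasurableSpace E] [BorelSpace E]
variable {F : Type*} [NormedAddCommGroup F] [InnerProductSpace ℝ F]

/-- **Green's formula with a multiplier**: for an open `Ω`, `w ∈ C^∞(Ω)`, and `V` smooth,
compactly supported with `tsupport V ⊆ Ω`,
`∫ w ⟪V, ΔV⟫ = ½ ∫ (Δw) |V|² - ∫ w |∇V|²` (Green in space, then the transport identity with the
field `∇w`, `div ∇w = Δw`). This is the identity behind Li–Šverák's `(Sv, Fv)` computation
(paper, display before (4.3)). [cite: LiSverak2012, §4 (4.3)] -/
theorem integral_mul_inner_lap_self_of_open {Ω : Set (ℝ × E)} (hΩ : IsOpen Ω) {w : ℝ × E → ℝ}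
    (hw : ContDiffOn ℝ (⊤ : ℕ∞) w Ω) {V : ℝ × E → F} (hV : ContDiff ℝ (⊤ : ℕ∞) V)
    (hVc : HasCompactSupport V) (hVΩ : tsupport V ⊆ Ω) :
    ∫ z, w z * ⟪V z, lap V z⟫ = 1 / 2 * (∫ z, lap w z * ‖V z‖ ^ 2) - ∫ z, w z * gradSq V z := by
  set b := stdOrthonormalBasis ℝ E with hb
  have hV1 : ContDiff ℝ 1 V := hV.of_le (by exact_mod_cast le_top)
  have hw1 : ContDiffOn ℝ 1 w Ω := hw.of_le (by exact_mod_cast le_top)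
  have hV00 : ∀ z ∉ Ω, V z = 0 := fun z hz => image_eq_zero_of_notMem_tsupport fun h => hz (hVΩ h)
  have hdxVΩ : ∀ i, tsupport (dx (b i) V) ⊆ Ω := fun i => (tsupport_dx_subset _ V).trans hVΩ
  have cw : ContinuousOn w Ω := hw.continuousOn
  have cdw : ∀ v, ContinuousOn (fun z => fderiv ℝ w z v) Ω := fun v =>
    (hw.continuousOn_fderiv_of_isOpen hΩ (by simp)).clm_apply continuousOn_const
  -- ## Green in space
  have hG := integral_mul_inner_lap_of_open hΩ hw1 hV1 hVc hVΩ hV hVc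
  simp only [← hb] at hG
  rw [hG]
  -- first sum: `Σᵢ ∫ ∂ᵢw ⟪V, ∂ᵢV⟫ = ∫ ⟪DV(0, ∇w), V⟫ = -½ ∫ Δw |V|²`
  have i1 : ∀ i, Integrable fun z : ℝ × E => fderiv ℝ w z (0, b i) * ⟪V z, dx (b i) V z⟫ :=
    fun i => integrable_mul_inner_of_open hΩ hVΩ (cdw _)
      hV.continuous.continuousOn (contDiff_dx hV _).continuous.continuousOn hVc subset_rfl
  have hfirst : ∑ i, ∫ z, fderiv ℝ w z (0, b i) * ⟪V z, dx (b i) V z⟫ =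
      ∫ z : ℝ × E, (1 : ℝ) * ⟪fderiv ℝ V z (0, gradX w z), V z⟫ := by
    rw [← integral_finsetSum _ fun i _ => i1 i]
    refine integral_congr_ae (Eventually.of_forall fun z => ?_)
    show ∑ i, fderiv ℝ w z (0, b i) * ⟪V z, dx (b i) V z⟫ = 1 * ⟪fderiv ℝ V z (0, gradX w z), V z⟫
    rw [fderiv_apply_gradX, sum_inner, one_mul]
    simp only [← hb]
    refine Finset.sum_congr rfl fun i _ => ?_
    simp only [real_inner_smul_left, dx_apply]
    rw [real_inner_comm (V z)]
  have htr : 2 * ∫ z : ℝ × E, (1 : ℝ) * ⟪fderiv ℝ V z (0, gradX w z), V z⟫ =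
      -∫ z : ℝ × E, lap w z * ‖V z‖ ^ 2 := by
    rw [two_mul_integral_mul_inner_fderiv_field_self hΩ contDiffOn_const
      ((contDiffOn_gradX hΩ hw).of_le (by exact_mod_cast le_top)) hV1 hVc hVΩ]
    congr 1
    refine integral_congr_ae (Eventually.of_forall fun z => ?_)
    show (fderiv ℝ (fun _ : ℝ × E => (1 : ℝ)) z (0, gradX w z) + 1 * divX (gradX w) z) * ‖V z‖ ^ 2 =
      lap w z * ‖V z‖ ^ 2
    by_cases hz : z ∈ Ω
    · simp [divX_gradX hΩ hw hz]
    · simp [hV00 z hz]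
  -- second sum
  have i2 : ∀ i, Integrable fun z : ℝ × E => w z * ‖dx (b i) V z‖ ^ 2 := fun i =>
    integrable_of_continuous_hasCompactSupport
      (continuous_mul_norm_sq_of_tsupport_subset hΩ cw (contDiff_dx hV _).continuous (hdxVΩ i))
      (hasCompactSupport_mul_norm_sq (hasCompactSupport_dx hVc _))
  have hsecond : ∑ i, ∫ z : ℝ × E, w z * ⟪dx (b i) V z, dx (b i) V z⟫ = ∫ z : ℝ × E, w z * gradSq V z := by
    have e1 : ∀ i, ∫ z : ℝ × E, w z * ⟪dx (b i) V z, dx (b i) V z⟫ = ∫ z : ℝ × E, w z * ‖dx (b i) V z‖ ^ 2 :=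
      fun i => integral_congr_ae (Eventually.of_forall fun z => by
        show w z * ⟪dx (b i) V z, dx (b i) V z⟫ = w z * ‖dx (b i) V z‖ ^ 2
        rw [real_inner_self_eq_norm_sq])
    rw [Finset.sum_congr rfl fun i _ => e1 i, ← integral_finsetSum _ fun i _ => i2 i]
    refine integral_congr_ae (Eventually.of_forall fun z => ?_)
    show ∑ i, w z * ‖dx (b i) V z‖ ^ 2 = w z * gradSq V z
    rw [gradSq, Finset.mul_sum]
  rw [hfirst, hsecond]
  linarith [htr]

end GreenMultiplier


/-! ### The gradient bracket and the multiplier `tG` -/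

section ConeGradient

variable {E : Type*} [NormedAddCommGroup E] [InnerProductSpace ℝ E] [FiniteDimensional ℝ E]
variable {F : Type*} [NormedAddCommGroup F] [InnerProductSpace ℝ F]

/-- **The Hessian term is compensated by the multiplier** (paper, (4.4)–(4.7):
`∫ 4φ,ₖₗ v,ₖ v,ₗ + F|∇v|² ≥ ∫ |∇v|²`): pointwise on `Ω ∩ {t ≤ 1}`, for `a ≥ 0`, `1/2 ≤ β ≤ 1`,
`η ≥ 0`, `4t² Σᵢⱼ φᵢⱼ ⟪∂ⱼv, ∂ᵢv⟫ + 2tG |∇v|² = 4t²ak₁[2β(2β-1)x₁^{2β-2}|Dv(0,e)|² + 4βη(1-β)(‖x‖²)^{β-2}|Dv(0,x)|²] ≥ 0`. [cite: LiSverak2012, §4 (4.4)–(4.7)] -/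
theorem cone_hess_gradient_nonneg {a β η : ℝ} (ha0 : 0 ≤ a) (hβ : 1 / 2 ≤ β) (hβ1 : β ≤ 1)
    (hη0 : 0 ≤ η) (e : E) {z : ℝ × E} (hz : z ∈ halfDom e) (ht1 : z.1 ≤ 1) (V : ℝ × E → F) :
    0 ≤ 4 * z.1 ^ 2 * ∑ i, ∑ j, dx (stdOrthonormalBasis ℝ E i)
        (dx (stdOrthonormalBasis ℝ E j) (conePhi a β η e)) z *
          ⟪dx (stdOrthonormalBasis ℝ E j) V z, dx (stdOrthonormalBasis ℝ E i) V z⟫ +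
      2 * z.1 * coneG a β η z * gradSq V z := by
  have hk0 : 0 ≤ kA 1 z.1 := kA_one_nonneg hz.1 ht1
  have hR0 : 0 < ‖z.2‖ ^ 2 := by
    have := snd_ne_zero_of_mem_halfDom hz
    positivity
  rw [sum_hess_conePhi_inner a β η e hz V, coneG]
  have e1 : 4 * z.1 ^ 2 * (a * kA 1 z.1 * (2 * β * (2 * β - 1) * ⟪z.2, e⟫ ^ (2 * β - 2) *
      ‖fderiv ℝ V z (0, e)‖ ^ 2 - η * (2 * β * (‖z.2‖ ^ 2) ^ (β - 1) * gradSq V z +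
        4 * β * (β - 1) * (‖z.2‖ ^ 2) ^ (β - 2) * ‖fderiv ℝ V z (0, z.2)‖ ^ 2))) +
      2 * z.1 * (2 * z.1 * (a * kA 1 z.1) * (2 * β * η * (‖z.2‖ ^ 2) ^ (β - 1))) * gradSq V z =
      4 * z.1 ^ 2 * (a * kA 1 z.1) * (2 * β * (2 * β - 1) * ⟪z.2, e⟫ ^ (2 * β - 2) * ‖fderiv ℝ V z (0, e)‖ ^ 2 +
        4 * β * η * (1 - β) * (‖z.2‖ ^ 2) ^ (β - 2) * ‖fderiv ℝ V z (0, z.2)‖ ^ 2) := by ring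
  rw [e1]
  have h1 : 0 ≤ 2 * β * (2 * β - 1) * ⟪z.2, e⟫ ^ (2 * β - 2) * ‖fderiv ℝ V z (0, e)‖ ^ 2 :=
    mul_nonneg (mul_nonneg (mul_nonneg (by linarith) (by linarith)) (Real.rpow_nonneg hz.2.le _)) (sq_nonneg _)
  have h2 : 0 ≤ 4 * β * η * (1 - β) * (‖z.2‖ ^ 2) ^ (β - 2) * ‖fderiv ℝ V z (0, z.2)‖ ^ 2 :=
    mul_nonneg (mul_nonneg (mul_nonneg (mul_nonneg (by linarith) hη0) (by linarith))
      (Real.rpow_nonneg hR0.le _)) (sq_nonneg _)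
  exact mul_nonneg (mul_nonneg (by positivity) (mul_nonneg ha0 hk0)) (by linarith)

omit [InnerProductSpace ℝ E] [FiniteDimensional ℝ E] in
/-- `tG` as a radial block: `tG = (4aβη t² k₁(t)) (‖x‖²)^{β-1}`. [folklore] -/
theorem coneTG_eq (a β η : ℝ) :
    (fun y : ℝ × E => y.1 * coneG a β η y) =
      fun y => (fun t => 4 * a * β * η * (t ^ 2 * kA 1 t)) y.1 * radPow (β - 1) y := by
  funext y
  simp only [coneG, radPow_apply]
  ring

omit [FiniteDimensional ℝ E] in
/-- `tG ∈ C^∞(Ω)`. [folklore] -/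
theorem contDiffOn_coneTG (a β η : ℝ) (e : E) :
    ContDiffOn ℝ (⊤ : ℕ∞) (fun y : ℝ × E => y.1 * coneG a β η y) (halfDom e) :=
  contDiffOn_fst.mul (contDiffOn_coneG a β η e)

/-- **`Δ(tG) = t ΔG`** on `Ω` (the multiplier's time factor is constant in `x`). [folklore] -/
theorem lap_coneTG (a β η : ℝ) (e : E) {z : ℝ × E} (hz : z ∈ halfDom e) :
    lap (fun y : ℝ × E => y.1 * coneG a β η y) z = z.1 * lap (coneG a β η) z := by
  have hf : ContDiffOn ℝ (⊤ : ℕ∞) (fun t : ℝ => 4 * a * β * η * (t ^ 2 * kA 1 t)) (Ioi 0) :=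
    contDiffOn_const.mul ((contDiffOn_id.pow 2).mul (contDiffOn_kA 1))
  rw [coneTG_eq, lap_sepRad hf (β - 1) e hz, lap_coneG a β η e hz, radPow_apply,
    show β - 1 - 1 = β - 2 by ring]
  ring

end ConeGradient


/-! ## The Carleman inequality in the cone (Li–Šverák 2012, Prop. 2.3) -/

section ConeCarlemanTools

variable {E : Type*} [NormedAddCommGroup E] [InnerProductSpace ℝ E] [FiniteDimensional ℝ E]
  [MeasurableSpace E] [BorelSpace E]
variable {F : Type*} [NormedAddCommGroup F] [InnerProductSpace ℝ F]
variable {Ω : Set (ℝ × E)} {φ : ℝ × E → ℝ} {V : ℝ × E → F}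
variable (hΩ : IsOpen Ω) (hφ : ContDiffOn ℝ (⊤ : ℕ∞) φ Ω)
  (hV : ContDiff ℝ (⊤ : ℕ∞) V) (hVc : HasCompactSupport V) (hVΩ : tsupport V ⊆ Ω)
include hΩ hφ hV hVc hVΩ

/-- The Hessian pairing of (A.1.6) as a single integral:
`Σᵢⱼ ∫ t² φᵢⱼ ⟪∂ⱼv, ∂ᵢv⟫ = ∫ t² Σᵢⱼ φᵢⱼ ⟪∂ⱼv, ∂ᵢv⟫`, the integrand being integrable. [folklore] -/
theorem integral_hess_sum_eq :
    Integrable (fun z => z.1 ^ 2 * ∑ i, ∑ j, dx (stdOrthonormalBasis ℝ E i) (dx (stdOrthonormalBasis ℝ E j) φ) z *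
        ⟪dx (stdOrthonormalBasis ℝ E j) V z, dx (stdOrthonormalBasis ℝ E i) V z⟫) ∧
      ∑ i, ∑ j, ∫ z, z.1 ^ 2 * dx (stdOrthonormalBasis ℝ E i) (dx (stdOrthonormalBasis ℝ E j) φ) z *
          ⟪dx (stdOrthonormalBasis ℝ E j) V z, dx (stdOrthonormalBasis ℝ E i) V z⟫ =
        ∫ z, z.1 ^ 2 * ∑ i, ∑ j, dx (stdOrthonormalBasis ℝ E i) (dx (stdOrthonormalBasis ℝ E j) φ) z *
          ⟪dx (stdOrthonormalBasis ℝ E j) V z, dx (stdOrthonormalBasis ℝ E i) V z⟫ := by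
  set b := stdOrthonormalBasis ℝ E with hb
  have ct2 : ContinuousOn (fun z : ℝ × E => z.1 ^ 2) Ω := (continuous_fst.pow 2).continuousOn
  have cφij : ∀ i j, ContinuousOn (fun z => dx (b i) (dx (b j) φ) z) Ω := fun i j =>
    (contDiffOn_fderiv_apply_const_of_open hΩ (contDiffOn_dx hΩ hφ _) _).continuousOn
  have iHij : ∀ i j, Integrable fun z => z.1 ^ 2 * dx (b i) (dx (b j) φ) z * ⟪dx (b j) V z, dx (b i) V z⟫ :=
    fun i j => integrable_mul_inner_of_open hΩ hVΩ (ct2.mul (cφij i j))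
      (contDiff_dx hV _).continuous.continuousOn (contDiff_dx hV _).continuous.continuousOn
      (hasCompactSupport_dx hVc _) (tsupport_dx_subset _ _)
  have hpt : ∀ z, ∑ i, ∑ j, z.1 ^ 2 * dx (b i) (dx (b j) φ) z * ⟪dx (b j) V z, dx (b i) V z⟫ =
      z.1 ^ 2 * ∑ i, ∑ j, dx (b i) (dx (b j) φ) z * ⟪dx (b j) V z, dx (b i) V z⟫ := by
    intro z
    rw [Finset.mul_sum]
    refine Finset.sum_congr rfl fun i _ => ?_
    rw [Finset.mul_sum]
    refine Finset.sum_congr rfl fun j _ => ?_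
    ring
  have iH : Integrable fun z => z.1 ^ 2 * ∑ i, ∑ j, dx (b i) (dx (b j) φ) z * ⟪dx (b j) V z, dx (b i) V z⟫ :=
    (integrable_finsetSum (Finset.univ) fun i _ =>
      integrable_finsetSum (Finset.univ) fun j _ => iHij i j).congr (Eventually.of_forall hpt)
  refine ⟨iH, ?_⟩
  have h1 : ∀ i, ∑ j, ∫ z, z.1 ^ 2 * dx (b i) (dx (b j) φ) z * ⟪dx (b j) V z, dx (b i) V z⟫ =
      ∫ z, ∑ j, z.1 ^ 2 * dx (b i) (dx (b j) φ) z * ⟪dx (b j) V z, dx (b i) V z⟫ := fun i =>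
    (integral_finsetSum _ fun j _ => iHij i j).symm
  rw [Finset.sum_congr rfl fun i _ => h1 i, ← integral_finsetSum _ fun i _ =>
    integrable_finsetSum _ fun j _ => iHij i j]
  exact integral_congr_ae (Eventually.of_forall hpt)

/-- **Li–Šverák's multiplier estimate** (paper, (4.3): `(Sv,Sv) ≥ -(Sv,Fv) - ¼∫F²v²` and the
evaluation of `(Sv, Fv)`), for Seregin's symmetric part `S v = t(Δv + qv) - v/2` and a
multiplier `G ∈ C^∞(Ω)`:
`∫|Sv|² ≥ 2∫ tG|∇v|² - ∫ Δ(tG)|v|² - 2∫ tGq|v|² + ∫ G|v|² - ∫ G²|v|²`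
(`|Sv|² ≥ -2G⟪v,Sv⟫ - G²|v|²` pointwise, `⟪v,Sv⟫ = t⟪v,Δv⟫ + tq|v|² - ½|v|²`, and Green's formula
with the multiplier `tG`). [cite: LiSverak2012, §4 (4.3)] -/
theorem multiplier_le_integral_opSW_sq {G : ℝ × E → ℝ} (hG : ContDiffOn ℝ (⊤ : ℕ∞) G Ω) :
    2 * (∫ z, z.1 * G z * gradSq V z) - (∫ z, lap (fun y : ℝ × E => y.1 * G y) z * ‖V z‖ ^ 2) -
        2 * (∫ z, z.1 * G z * qW φ z * ‖V z‖ ^ 2) + (∫ z, G z * ‖V z‖ ^ 2) -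
        (∫ z, G z ^ 2 * ‖V z‖ ^ 2) ≤ ∫ z, ‖opSW φ V z‖ ^ 2 := by
  have hV00 : ∀ z ∉ tsupport V, V z = 0 := fun z hz => image_eq_zero_of_notMem_tsupport hz
  have hdV0 : ∀ z ∉ tsupport V, fderiv ℝ V z = 0 := fun z hz => fderiv_of_notMem_tsupport (𝕜 := ℝ) hz
  have hGV0 : ∀ z ∉ tsupport V, gradSq V z = 0 := fun z hz => by simp [gradSq, dx, hdV0 z hz]
  have cV : Continuous V := hV.continuous
  have cS : Continuous (opSW φ V) := continuous_opSW hΩ hφ hV hVΩ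
  have clapV : Continuous (lap V) := (contDiff_lap hV).continuous
  have cGV : Continuous (gradSq V) := by
    unfold gradSq
    exact continuous_finsetSum _ fun i _ => ((contDiff_dx hV _).continuous.norm.pow 2)
  have ct : ContinuousOn (fun z : ℝ × E => z.1) Ω := continuous_fst.continuousOn
  have cG : ContinuousOn G Ω := hG.continuousOn
  have htG : ContDiffOn ℝ (⊤ : ℕ∞) (fun y : ℝ × E => y.1 * G y) Ω := contDiffOn_fst.mul hG
  have ctG : ContinuousOn (fun z : ℝ × E => z.1 * G z) Ω := ct.mul cG
  have cq : ContinuousOn (qW φ) Ω := (contDiffOn_qW hΩ hφ).continuousOn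
  have hSs : tsupport (opSW φ V) ⊆ tsupport V := tsupport_opSW_subset
  have hSc : HasCompactSupport (opSW φ V) := hVc.mono' ((subset_tsupport _).trans hSs)
  have hS2c : HasCompactSupport (fun z => ‖opSW φ V z‖ ^ 2) := hSc.comp_left (g := fun y : F => ‖y‖ ^ 2) (by simp)
  have iS : Integrable fun z => ‖opSW φ V z‖ ^ 2 := (cS.norm.pow 2).integrable_of_hasCompactSupport hS2c
  -- the multiplier, pointwise
  have iGS : Integrable fun z => G z * ⟪V z, opSW φ V z⟫ :=
    integrable_mul_inner_of_open hΩ hVΩ cG cV.continuousOn cS.continuousOn hVc subset_rfl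
  have iG2 : Integrable fun z => G z ^ 2 * ‖V z‖ ^ 2 :=
    integrable_mul_norm_sq_of_open hΩ hV hVc hVΩ (w := fun z => G z ^ 2) (cG.pow 2)
  have hmult : -2 * (∫ z, G z * ⟪V z, opSW φ V z⟫) - (∫ z, G z ^ 2 * ‖V z‖ ^ 2) ≤ ∫ z, ‖opSW φ V z‖ ^ 2 := by
    rw [← integral_const_mul, ← integral_sub (iGS.const_mul _) iG2]
    refine integral_mono ((iGS.const_mul _).sub iG2) iS fun z => ?_
    show -2 * (G z * ⟪V z, opSW φ V z⟫) - G z ^ 2 * ‖V z‖ ^ 2 ≤ ‖opSW φ V z‖ ^ 2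
    have h := norm_add_sq_real (opSW φ V z) (G z • V z)
    rw [inner_smul_right, norm_smul, mul_pow, Real.norm_eq_abs, sq_abs, real_inner_comm] at h
    nlinarith [sq_nonneg ‖opSW φ V z + G z • V z‖, h]
  -- `⟪v, Sv⟫ = t⟪v,Δv⟫ + tq|v|² - ½|v|²`
  have itGL : Integrable fun z => z.1 * G z * ⟪V z, lap V z⟫ :=
    integrable_mul_inner_of_open hΩ hVΩ ctG cV.continuousOn clapV.continuousOn hVc subset_rfl
  have itGq : Integrable fun z => z.1 * G z * qW φ z * ‖V z‖ ^ 2 :=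
    integrable_mul_norm_sq_of_open hΩ hV hVc hVΩ (w := fun z => z.1 * G z * qW φ z) (ctG.mul cq)
  have iGV : Integrable fun z => G z * ‖V z‖ ^ 2 := integrable_mul_norm_sq_of_open hΩ hV hVc hVΩ cG
  have i12 : Integrable fun z => z.1 * G z * ⟪V z, lap V z⟫ + z.1 * G z * qW φ z * ‖V z‖ ^ 2 := itGL.add itGq
  have iGV' : Integrable fun z => 1 / 2 * (G z * ‖V z‖ ^ 2) := iGV.const_mul _
  have hGS : ∫ z, G z * ⟪V z, opSW φ V z⟫ = (∫ z, z.1 * G z * ⟪V z, lap V z⟫) +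
      (∫ z, z.1 * G z * qW φ z * ‖V z‖ ^ 2) - 1 / 2 * ∫ z, G z * ‖V z‖ ^ 2 := by
    rw [← integral_add itGL itGq, ← integral_const_mul, ← integral_sub i12 iGV']
    refine integral_congr_ae (Eventually.of_forall fun z => ?_)
    show G z * ⟪V z, opSW φ V z⟫ =
      z.1 * G z * ⟪V z, lap V z⟫ + z.1 * G z * qW φ z * ‖V z‖ ^ 2 - 1 / 2 * (G z * ‖V z‖ ^ 2)
    simp only [opSW, inner_sub_right, inner_smul_right, inner_add_right, real_inner_self_eq_norm_sq]
    ring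
  -- Green with the multiplier `tG`
  have hGreen := integral_mul_inner_lap_self_of_open hΩ htG hV hVc hVΩ
  have e1 : ∫ z, (fun y : ℝ × E => y.1 * G y) z * ⟪V z, lap V z⟫ = ∫ z, z.1 * G z * ⟪V z, lap V z⟫ := rfl
  have e2 : ∫ z, (fun y : ℝ × E => y.1 * G y) z * gradSq V z = ∫ z, z.1 * G z * gradSq V z := rfl
  rw [e1, e2] at hGreen
  linarith [hmult, hGS, hGreen]

end ConeCarlemanTools

section ConeCarleman

variable {E : Type*} [NormedAddCommGroup E] [InnerProductSpace ℝ E] [FiniteDimensional ℝ E]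
  [MeasurableSpace E] [BorelSpace E]
variable {F : Type*} [NormedAddCommGroup F] [InnerProductSpace ℝ F]

set_option maxHeartbeats 1600000 in
/-- **Li–Šverák 2012, Prop. 2.3 — the anisotropic Carleman inequality in a cone, proved** (in
Seregin's `t`-weighted `L₂` form, with the profile `k₁(t) = (1-t)/t`): let `E` be a
finite-dimensional real inner product space (`d = dim E`), `e` a unit vector, `0 ≤ ε`,
`1/2 < β ≤ 1`, `η = ε^{2β}` (so `α = 2β`, `η = ε^α`) with
`m(α, ε) = (2β-1-2η)(1-η)² - 2ηε²(1-ε²) ≥ 0`, `2β - 1 - 2η ≥ 0`,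
`c₂ = 8β²(1-η)² - 8βη(1-η) - 4β²η² > 0` (for `ε < 1/√3` all three hold for `β < 1` close to `1`,
cf. `m(2, ε) = (1-ε²)(1-3ε²)`), and `a ≥ 0` with `a c₂ ≥ 2(1-β)·9(d+4)²`. Then for every smooth
`u` compactly supported in the truncated cone `Q = ]0,1[ × ({ε|x| < ⟪x,e⟫} ∩ {⟪x,e⟫ > 1})`, with
`φ = t² + a k₁(t)(⟪x,e⟫^{2β} - η(‖x‖²)^β)`,

  `∫ ((c₂/2) a² k₁(t) + a φ₀(x)) e^{2φ}|u|² + ½ ∫ t e^{2φ}|∇u|² ≤ ∫ t² e^{2φ}|∂ₜu + Δu|²`.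

(The source: `∫ e^{2φ}[a(Λ + φ₀)u² + |∇u|²] ≤ 4∫ e^{2φ}|∂ₜu + Δu|²` on `Q_θ`, `φ = aΛφ₀ + t²`,
`Λ = (1-t)t^{-α/2}`, for `α ∈ ]α(ε), 2[`, `a > a₀`.) Proof: Seregin's splitting `tL = S + A`
(`CarlemanConjugate`, `CarlemanCommutator`: `∫ t²|Lv|² = ∫|Sv|² + ∫|Av|² + 2∫⟪Sv,Av⟫` and the
identity (A.1.6) for `2∫⟪Sv,Av⟫`), Li–Šverák's multiplier `∫|Sv|² ≥ -2∫G⟪Sv,v⟫ - ∫G²|v|²`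
with `G = 2t a k₁ f`, `f = αε^α|x|^{α-2}` compensating the non-convexity of `φ₀`
(`cone_hess_gradient_nonneg`), and the pointwise lower bound of the resulting zeroth-order
weight (`cone_weight_lower_bound`: orders `a³ ≥ 0` by `m ≥ 0`, `a²` absorbing the reserve
`t|∇φ|²`, `a¹`-junk of size `(1-β)`). [cite: LiSverak2012, Prop. 2.3] -/
theorem carleman_inequality_cone {β ε η a : ℝ} (hβ : 1 / 2 < β) (hβ1 : β ≤ 1) (hε0 : 0 ≤ ε)
    (hη : η = ε ^ (2 * β)) (hκ : 0 ≤ 2 * β - 1 - 2 * η)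
    (hm : 0 ≤ (2 * β - 1 - 2 * η) * (1 - η) ^ 2 - 2 * η * ε ^ 2 * (1 - ε ^ 2))
    (hc₂ : 0 < 8 * β ^ 2 * (1 - η) ^ 2 - 8 * β * η * (1 - η) - 4 * β ^ 2 * η ^ 2) (ha0 : 0 ≤ a)
    (ha : 2 * ((1 - β) * (9 * ((Module.finrank ℝ E : ℝ) + 4) ^ 2)) ≤
      a * (8 * β ^ 2 * (1 - η) ^ 2 - 8 * β * η * (1 - η) - 4 * β ^ 2 * η ^ 2))
    {e : E} (he : ‖e‖ = 1) {U : ℝ × E → F} (hU : ContDiff ℝ (⊤ : ℕ∞) U)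
    (hUc : HasCompactSupport U)
    (hUs : tsupport U ⊆ Ioo (0 : ℝ) 1 ×ˢ {x : E | ε * ‖x‖ < ⟪x, e⟫ ∧ 1 < ⟪x, e⟫}) :
    (∫ z, ((8 * β ^ 2 * (1 - η) ^ 2 - 8 * β * η * (1 - η) - 4 * β ^ 2 * η ^ 2) / 2 * a ^ 2 * kA 1 z.1 +
          a * conePhi0 β η e z.2) * Real.exp (2 * conePhi a β η e z) * ‖U z‖ ^ 2) +
      1 / 2 * ∫ z, z.1 * Real.exp (2 * conePhi a β η e z) * gradSq U z ≤
      ∫ z, z.1 ^ 2 * Real.exp (2 * conePhi a β η e z) * ‖dt U z + lap U z‖ ^ 2 := by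
  set φ : ℝ × E → ℝ := conePhi a β η e with hφdef
  set Zw : ℝ × E → ℝ := fun z => (8 * β ^ 2 * (1 - η) ^ 2 - 8 * β * η * (1 - η) - 4 * β ^ 2 * η ^ 2) / 2 *
    a ^ 2 * kA 1 z.1 + a * conePhi0 β η e z.2 with hZw
  set G : ℝ × E → ℝ := coneG a β η with hGdef
  set b := stdOrthonormalBasis ℝ E with hb
  -- ## degenerate case: `u = 0`
  by_cases hne : (tsupport U).Nonempty
  swap
  · have hU0 : ∀ z, U z = 0 := fun z =>
      image_eq_zero_of_notMem_tsupport fun h => hne ⟨z, h⟩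
    have hdU0 : ∀ z, fderiv ℝ U z = 0 := fun z =>
      fderiv_of_notMem_tsupport (𝕜 := ℝ) fun h => hne ⟨z, h⟩
    have hlap0 : ∀ z, lap U z = 0 := fun z =>
      image_eq_zero_of_notMem_tsupport fun h => hne ⟨z, tsupport_lap_subset U h⟩
    have hg0 : ∀ z, gradSq U z = 0 := fun z => by simp [gradSq, dx, hdU0 z]
    simp [hU0, hg0, hlap0, dt, hdU0]
  -- ## geometry of the support
  set Ω : Set (ℝ × E) := halfDom e with hΩdef
  have hΩ : IsOpen Ω := isOpen_halfDom e
  have hφ : ContDiffOn ℝ (⊤ : ℕ∞) φ Ω := contDiffOn_conePhi a β η e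
  obtain ⟨z₀, hz₀, hmin⟩ := hUc.isCompact.exists_isMinOn hne continuous_fst.continuousOn
  set δ : ℝ := z₀.1 with hδdef
  have hδ : 0 < δ := (hUs hz₀).1.1
  have hUδ : tsupport U ⊆ {z | δ ≤ z.1} := fun z hz => hmin hz
  have hUin : ∀ z ∈ tsupport U, 0 < z.1 ∧ z.1 < 1 ∧ ε * ‖z.2‖ < ⟪z.2, e⟫ ∧ 1 < ⟪z.2, e⟫ := fun z hz =>
    ⟨(hUs hz).1.1, (hUs hz).1.2, (hUs hz).2.1, (hUs hz).2.2⟩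
  have hUΩ : tsupport U ⊆ Ω := fun z hz => ⟨(hUin z hz).1, by linarith only [(hUin z hz).2.2.2]⟩
  -- ## the conjugated field
  set V : ℝ × E → F := expConj φ U with hVdef
  have hV : ContDiff ℝ (⊤ : ℕ∞) V := contDiff_expConj hΩ hφ hU hUΩ
  have hVs : tsupport V ⊆ tsupport U := tsupport_expConj_subset
  have hVc : HasCompactSupport V := hasCompactSupport_expConj hUc
  have hVΩ : tsupport V ⊆ Ω := hVs.trans hUΩ
  have hVδ : tsupport V ⊆ {z | δ ≤ z.1} := hVs.trans hUδ
  have hVin : ∀ z ∈ tsupport V, 0 < z.1 ∧ z.1 < 1 ∧ ε * ‖z.2‖ < ⟪z.2, e⟫ ∧ 1 < ⟪z.2, e⟫ :=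
    fun z hz => hUin z (hVs hz)
  have hV00 : ∀ z ∉ tsupport V, V z = 0 := fun z hz => image_eq_zero_of_notMem_tsupport hz
  have hdV0 : ∀ z ∉ tsupport V, fderiv ℝ V z = 0 := fun z hz => fderiv_of_notMem_tsupport (𝕜 := ℝ) hz
  have hGV0 : ∀ z ∉ tsupport V, gradSq V z = 0 := fun z hz => by simp [gradSq, dx, hdV0 z hz]
  have hnV : ∀ z, ‖V z‖ ^ 2 = Real.exp (φ z) ^ 2 * ‖U z‖ ^ 2 := fun z => by
    rw [hVdef, expConj_apply, norm_smul, Real.norm_eq_abs, abs_of_pos (Real.exp_pos _)]; ring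
  -- ## continuity / integrability toolkit
  have cV : Continuous V := hV.continuous
  have cS : Continuous (opSW φ V) := continuous_opSW hΩ hφ hV hVΩ
  have cA : Continuous (opAW φ V) := continuous_opAW hΩ hφ hV hVΩ
  have cSA : Continuous fun z => opSW φ V z + opAW φ V z := cS.add cA
  have cGV : Continuous (gradSq V) := by
    unfold gradSq
    exact continuous_finsetSum _ fun i _ => ((contDiff_dx hV _).continuous.norm.pow 2)
  have ct : ContinuousOn (fun z : ℝ × E => z.1) Ω := continuous_fst.continuousOn
  have ct2 : ContinuousOn (fun z : ℝ × E => z.1 ^ 2) Ω := (continuous_fst.pow 2).continuousOn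
  have hGs : ContDiffOn ℝ (⊤ : ℕ∞) G Ω := contDiffOn_coneG a β η e
  have cG : ContinuousOn G Ω := hGs.continuousOn
  have ctG : ContinuousOn (fun z : ℝ × E => z.1 * G z) Ω := ct.mul cG
  have clapG : ContinuousOn (lap G) Ω := (contDiffOn_lap_of_open hΩ hGs).continuousOn
  have cq : ContinuousOn (qW φ) Ω := (contDiffOn_qW hΩ hφ).continuousOn
  have cN : ContinuousOn (fun z => ‖gradX φ z‖ ^ 2) Ω := ((contDiffOn_gradX hΩ hφ).continuousOn.norm).pow 2
  have clap2φ : ContinuousOn (lap (lap φ)) Ω :=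
    (contDiffOn_lap_of_open hΩ (contDiffOn_lap_of_open hΩ hφ)).continuousOn
  have cdtdt : ContinuousOn (dt (dt φ)) Ω :=
    (contDiffOn_fderiv_apply_const_of_open hΩ (contDiffOn_dt hΩ hφ) _).continuousOn
  have cdtg : ContinuousOn (dt (fun y => ‖gradX φ y‖ ^ 2)) Ω :=
    (contDiffOn_fderiv_apply_const_of_open hΩ ((contDiffOn_gradX hΩ hφ).norm_sq ℝ) _).continuousOn
  have cφij : ∀ i j, ContinuousOn (fun z => dx (b i) (dx (b j) φ) z) Ω := fun i j =>
    (contDiffOn_fderiv_apply_const_of_open hΩ (contDiffOn_dx hΩ hφ _) _).continuousOn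
  have cφi : ∀ i, ContinuousOn (dx (b i) φ) Ω := fun i => (contDiffOn_dx hΩ hφ _).continuousOn
  have cHg : ContinuousOn (fun z => ∑ i, ∑ j, dx (b i) (dx (b j) φ) z * dx (b i) φ z * dx (b j) φ z) Ω :=
    continuousOn_finsetSum _ fun i _ => continuousOn_finsetSum _ fun j _ => ((cφij i j).mul (cφi i)).mul (cφi j)
  have hSAs : tsupport (fun z => opSW φ V z + opAW φ V z) ⊆ tsupport V := by
    refine closure_minimal (fun z hz => ?_) (isClosed_tsupport V)
    by_contra h
    have h1 : opSW φ V z = 0 := image_eq_zero_of_notMem_tsupport fun h' => h (tsupport_opSW_subset h')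
    have h2 : opAW φ V z = 0 := image_eq_zero_of_notMem_tsupport fun h' => h (tsupport_opAW_subset h')
    exact hz (by simp [h1, h2])
  have hSs : tsupport (opSW φ V) ⊆ tsupport V := tsupport_opSW_subset
  have hAs : tsupport (opAW φ V) ⊆ tsupport V := tsupport_opAW_subset
  have hSc : HasCompactSupport (opSW φ V) := hVc.mono' ((subset_tsupport _).trans hSs)
  have hAc : HasCompactSupport (opAW φ V) := hVc.mono' ((subset_tsupport _).trans hAs)
  have hSAc : HasCompactSupport fun z => opSW φ V z + opAW φ V z := hVc.mono' ((subset_tsupport _).trans hSAs)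
  have hSA2c : HasCompactSupport (fun z => ‖opSW φ V z + opAW φ V z‖ ^ 2) :=
    hSAc.comp_left (g := fun y : F => ‖y‖ ^ 2) (by simp)
  have hS2c : HasCompactSupport (fun z => ‖opSW φ V z‖ ^ 2) := hSc.comp_left (g := fun y : F => ‖y‖ ^ 2) (by simp)
  have hA2c : HasCompactSupport (fun z => ‖opAW φ V z‖ ^ 2) := hAc.comp_left (g := fun y : F => ‖y‖ ^ 2) (by simp)
  have iJ : Integrable fun z => ‖opSW φ V z + opAW φ V z‖ ^ 2 :=
    (cSA.norm.pow 2).integrable_of_hasCompactSupport hSA2c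
  have iS : Integrable fun z => ‖opSW φ V z‖ ^ 2 := (cS.norm.pow 2).integrable_of_hasCompactSupport hS2c
  have iA : Integrable fun z => ‖opAW φ V z‖ ^ 2 := (cA.norm.pow 2).integrable_of_hasCompactSupport hA2c
  have iSA : Integrable fun z => ⟪opSW φ V z, opAW φ V z⟫ :=
    (continuous_inner.comp (cS.prodMk cA)).integrable_of_hasCompactSupport
      (hAc.mono fun z hz => by
        contrapose! hz
        simp [notMem_support.1 hz])
  -- ## `J = ∫ t² e^{2φ} |∂ₜu + Δu|²` ((A.1.2)) and `J = ∫|Sv|² + ∫|Av|² + 2∫⟪Sv,Av⟫`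
  have hJ : ∫ z, ‖opSW φ V z + opAW φ V z‖ ^ 2 = ∫ z, z.1 ^ 2 * Real.exp (2 * φ z) * ‖dt U z + lap U z‖ ^ 2 := by
    refine integral_congr_ae (Eventually.of_forall fun z => ?_)
    show ‖opSW φ V z + opAW φ V z‖ ^ 2 = z.1 ^ 2 * Real.exp (2 * φ z) * ‖dt U z + lap U z‖ ^ 2
    rw [hVdef, opSW_add_opAW_expConj hΩ hφ hU hUΩ z, norm_smul, mul_pow, Real.norm_eq_abs, sq_abs,
      exp_two_mul_eq_sq]
    ring
  have hJsplit : ∫ z, ‖opSW φ V z + opAW φ V z‖ ^ 2 = (∫ z, ‖opSW φ V z‖ ^ 2) + (∫ z, ‖opAW φ V z‖ ^ 2) +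
      2 * ∫ z, ⟪opSW φ V z, opAW φ V z⟫ := by
    have hexp : ∀ z, ‖opSW φ V z + opAW φ V z‖ ^ 2 =
        ‖opSW φ V z‖ ^ 2 + ‖opAW φ V z‖ ^ 2 + 2 * ⟪opSW φ V z, opAW φ V z⟫ := fun z => by
      rw [norm_add_sq_real]; ring
    have i12 : Integrable (fun z => ‖opSW φ V z‖ ^ 2 + ‖opAW φ V z‖ ^ 2) := iS.add iA
    have iSA2 : Integrable (fun z => 2 * ⟪opSW φ V z, opAW φ V z⟫) := iSA.const_mul 2
    rw [integral_congr_ae (Eventually.of_forall hexp), integral_add i12 iSA2, integral_add iS iA,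
      integral_const_mul]
  have hA0 : 0 ≤ ∫ z, ‖opAW φ V z‖ ^ 2 := integral_nonneg fun z => sq_nonneg _
  -- ## the commutator identity (A.1.6), the Hessian sum, the multiplier
  have hI := two_mul_integral_inner_opSW_opAW_printed hΩ hφ hδ hV hVc hVΩ hVδ
  obtain ⟨iH, hHsum⟩ := integral_hess_sum_eq hΩ hφ hV hVc hVΩ
  rw [hHsum] at hI
  simp only [← hb] at hI iH
  have hmult := multiplier_le_integral_opSW_sq hΩ hφ hV hVc hVΩ hGs
  have hlapTG : ∫ z, lap (fun y : ℝ × E => y.1 * G y) z * ‖V z‖ ^ 2 = ∫ z, z.1 * lap G z * ‖V z‖ ^ 2 := by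
    refine integral_congr_ae (Eventually.of_forall fun z => ?_)
    show lap (fun y : ℝ × E => y.1 * G y) z * ‖V z‖ ^ 2 = z.1 * lap G z * ‖V z‖ ^ 2
    by_cases hz : z ∈ Ω
    · rw [hGdef, lap_coneTG a β η e hz]
    · simp [hV00 z fun h => hz (hVΩ h)]
  rw [hlapTG] at hmult
  -- ## integrability of the remaining weighted squares
  have itGq : Integrable fun z => z.1 * G z * qW φ z * ‖V z‖ ^ 2 :=
    integrable_mul_norm_sq_of_open hΩ hV hVc hVΩ (w := fun z => z.1 * G z * qW φ z) (ctG.mul cq)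
  have iGV : Integrable fun z => G z * ‖V z‖ ^ 2 := integrable_mul_norm_sq_of_open hΩ hV hVc hVΩ cG
  have iG2 : Integrable fun z => G z ^ 2 * ‖V z‖ ^ 2 :=
    integrable_mul_norm_sq_of_open hΩ hV hVc hVΩ (w := fun z => G z ^ 2) (cG.pow 2)
  have itlapG : Integrable fun z => z.1 * lap G z * ‖V z‖ ^ 2 :=
    integrable_mul_norm_sq_of_open hΩ hV hVc hVΩ (w := fun z => z.1 * lap G z) (ct.mul clapG)
  have itGgrad : Integrable fun z => z.1 * G z * gradSq V z := by
    refine integrable_of_continuous_hasCompactSupport ?_ ?_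
    · exact continuous_of_continuousOn_of_eq_zero hΩ (isClosed_tsupport V) hVΩ (ctG.mul cGV.continuousOn)
        fun z hz => by simp [hGV0 z hz]
    · exact hVc.mono' fun z hz => by
        contrapose! hz
        simp [hGV0 z hz]
  -- ## the gradient bracket is nonnegative
  have hgrad : 0 ≤ 4 * (∫ z, z.1 ^ 2 * ∑ i, ∑ j, dx (b i) (dx (b j) φ) z * ⟪dx (b j) V z, dx (b i) V z⟫) +
      2 * ∫ z, z.1 * G z * gradSq V z := by
    rw [← integral_const_mul, ← integral_const_mul, ← integral_add (iH.const_mul _) (itGgrad.const_mul _)]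
    refine integral_nonneg fun z => ?_
    show 0 ≤ 4 * (z.1 ^ 2 * ∑ i, ∑ j, dx (b i) (dx (b j) φ) z * ⟪dx (b j) V z, dx (b i) V z⟫) +
      2 * (z.1 * G z * gradSq V z)
    by_cases hz : z ∈ tsupport V
    · have hη0 : 0 ≤ η := by rw [hη]; exact Real.rpow_nonneg hε0 _
      have h := cone_hess_gradient_nonneg ha0 hβ.le hβ1 hη0 e (hVΩ hz) (hVin z hz).2.1.le V
      have e1 : 4 * (z.1 ^ 2 * ∑ i, ∑ j, dx (b i) (dx (b j) φ) z * ⟪dx (b j) V z, dx (b i) V z⟫) +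
          2 * (z.1 * G z * gradSq V z) =
          4 * z.1 ^ 2 * ∑ i, ∑ j, dx (stdOrthonormalBasis ℝ E i) (dx (stdOrthonormalBasis ℝ E j)
            (conePhi a β η e)) z * ⟪dx (stdOrthonormalBasis ℝ E j) V z, dx (stdOrthonormalBasis ℝ E i) V z⟫ +
            2 * z.1 * coneG a β η z * gradSq V z := by
        simp only [hφdef, hGdef, hb]; ring
      rw [e1]; exact h
    · have h0 : ∀ i, dx (b i) V z = 0 := fun i => by simp [dx, hdV0 z hz]
      simp only [h0, inner_zero_left, mul_zero, Finset.sum_const_zero, hGV0 z hz, add_zero]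
      exact le_refl _
  -- ## the zeroth-order weight as one integral
  set M : ℝ × E → ℝ := fun z =>
    4 * z.1 ^ 2 * (∑ i, ∑ j, dx (b i) (dx (b j) φ) z * dx (b i) φ z * dx (b j) φ z) +
      z.1 ^ 2 * (dt (dt φ) z - 2 * dt (fun y => ‖gradX φ y‖ ^ 2) z - lap (lap φ) z) -
      z.1 * qW φ z - z.1 * lap G z - 2 * z.1 * G z * qW φ z + G z - G z ^ 2 with hMdef
  have cM : ContinuousOn M Ω := by
    have c1 : ContinuousOn (fun z : ℝ × E => 4 * z.1 ^ 2 *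
        (∑ i, ∑ j, dx (b i) (dx (b j) φ) z * dx (b i) φ z * dx (b j) φ z)) Ω := (continuousOn_const.mul ct2).mul cHg
    have c2 : ContinuousOn (fun z : ℝ × E => z.1 ^ 2 *
        (dt (dt φ) z - 2 * dt (fun y => ‖gradX φ y‖ ^ 2) z - lap (lap φ) z)) Ω :=
      ct2.mul ((cdtdt.sub (continuousOn_const.mul cdtg)).sub clap2φ)
    have c3 : ContinuousOn (fun z : ℝ × E => z.1 * qW φ z) Ω := ct.mul cq
    have c4 : ContinuousOn (fun z : ℝ × E => z.1 * lap G z) Ω := ct.mul clapG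
    have c5 : ContinuousOn (fun z : ℝ × E => 2 * z.1 * G z * qW φ z) Ω := ((continuousOn_const.mul ct).mul cG).mul cq
    have c6 : ContinuousOn (fun z : ℝ × E => G z ^ 2) Ω := cG.pow 2
    exact (((((c1.add c2).sub c3).sub c4).sub c5).add cG).sub c6
  have iM := integrable_mul_norm_sq_of_open hΩ hV hVc hVΩ cM
  have i3 := integrable_mul_norm_sq_of_open hΩ hV hVc hVΩ (w := fun z => z.1 ^ 2 *
    (∑ i, ∑ j, dx (b i) (dx (b j) φ) z * dx (b i) φ z * dx (b j) φ z)) (ct2.mul cHg)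
  have i4 := integrable_mul_norm_sq_of_open hΩ hV hVc hVΩ (w := fun z => z.1 ^ 2 *
    (dt (dt φ) z - 2 * dt (fun y => ‖gradX φ y‖ ^ 2) z - lap (lap φ) z))
    (ct2.mul ((cdtdt.sub (continuousOn_const.mul cdtg)).sub clap2φ))
  have i5 := integrable_mul_norm_sq_of_open hΩ hV hVc hVΩ (w := fun z => z.1 * qW φ z) (ct.mul cq)
  have hMint : ∫ z, M z * ‖V z‖ ^ 2 =
      4 * (∫ z, z.1 ^ 2 * (∑ i, ∑ j, dx (b i) (dx (b j) φ) z * dx (b i) φ z * dx (b j) φ z) * ‖V z‖ ^ 2) +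
      (∫ z, z.1 ^ 2 * (dt (dt φ) z - 2 * dt (fun y => ‖gradX φ y‖ ^ 2) z - lap (lap φ) z) * ‖V z‖ ^ 2) -
      (∫ z, z.1 * qW φ z * ‖V z‖ ^ 2) - (∫ z, z.1 * lap G z * ‖V z‖ ^ 2) -
      2 * (∫ z, z.1 * G z * qW φ z * ‖V z‖ ^ 2) + (∫ z, G z * ‖V z‖ ^ 2) - ∫ z, G z ^ 2 * ‖V z‖ ^ 2 := by
    have j1 : Integrable fun z => 4 * (z.1 ^ 2 * (∑ i, ∑ j, dx (b i) (dx (b j) φ) z * dx (b i) φ z * dx (b j) φ z) *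
        ‖V z‖ ^ 2) := i3.const_mul _
    have j2 : Integrable fun z => 4 * (z.1 ^ 2 * (∑ i, ∑ j, dx (b i) (dx (b j) φ) z * dx (b i) φ z * dx (b j) φ z) *
        ‖V z‖ ^ 2) + z.1 ^ 2 * (dt (dt φ) z - 2 * dt (fun y => ‖gradX φ y‖ ^ 2) z - lap (lap φ) z) * ‖V z‖ ^ 2 :=
      j1.add i4
    have j3 : Integrable fun z => 4 * (z.1 ^ 2 * (∑ i, ∑ j, dx (b i) (dx (b j) φ) z * dx (b i) φ z * dx (b j) φ z) *
        ‖V z‖ ^ 2) + z.1 ^ 2 * (dt (dt φ) z - 2 * dt (fun y => ‖gradX φ y‖ ^ 2) z - lap (lap φ) z) * ‖V z‖ ^ 2 -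
        z.1 * qW φ z * ‖V z‖ ^ 2 := j2.sub i5
    have j4 : Integrable fun z => 4 * (z.1 ^ 2 * (∑ i, ∑ j, dx (b i) (dx (b j) φ) z * dx (b i) φ z * dx (b j) φ z) *
        ‖V z‖ ^ 2) + z.1 ^ 2 * (dt (dt φ) z - 2 * dt (fun y => ‖gradX φ y‖ ^ 2) z - lap (lap φ) z) * ‖V z‖ ^ 2 -
        z.1 * qW φ z * ‖V z‖ ^ 2 - z.1 * lap G z * ‖V z‖ ^ 2 := j3.sub itlapG
    have j5' : Integrable fun z => 2 * (z.1 * G z * qW φ z * ‖V z‖ ^ 2) := itGq.const_mul _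
    have j5 : Integrable fun z => 4 * (z.1 ^ 2 * (∑ i, ∑ j, dx (b i) (dx (b j) φ) z * dx (b i) φ z * dx (b j) φ z) *
        ‖V z‖ ^ 2) + z.1 ^ 2 * (dt (dt φ) z - 2 * dt (fun y => ‖gradX φ y‖ ^ 2) z - lap (lap φ) z) * ‖V z‖ ^ 2 -
        z.1 * qW φ z * ‖V z‖ ^ 2 - z.1 * lap G z * ‖V z‖ ^ 2 - 2 * (z.1 * G z * qW φ z * ‖V z‖ ^ 2) := j4.sub j5'
    have j6 : Integrable fun z => 4 * (z.1 ^ 2 * (∑ i, ∑ j, dx (b i) (dx (b j) φ) z * dx (b i) φ z * dx (b j) φ z) *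
        ‖V z‖ ^ 2) + z.1 ^ 2 * (dt (dt φ) z - 2 * dt (fun y => ‖gradX φ y‖ ^ 2) z - lap (lap φ) z) * ‖V z‖ ^ 2 -
        z.1 * qW φ z * ‖V z‖ ^ 2 - z.1 * lap G z * ‖V z‖ ^ 2 - 2 * (z.1 * G z * qW φ z * ‖V z‖ ^ 2) +
        G z * ‖V z‖ ^ 2 := j5.add iGV
    rw [← integral_const_mul, ← integral_const_mul, ← integral_add j1 i4, ← integral_sub j2 i5,
      ← integral_sub j3 itlapG, ← integral_sub j4 j5', ← integral_add j5 iGV, ← integral_sub j6 iG2]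
    refine integral_congr_ae (Eventually.of_forall fun z => ?_)
    simp only [hMdef]
    ring
  -- ## the pointwise lower bound of `M`
  have cφ0 : Continuous fun z : ℝ × E => conePhi0 β η e z.2 := by
    unfold conePhi0
    exact ((continuous_snd.inner continuous_const).rpow_const fun _ => Or.inr (by linarith)).sub
      (continuous_const.mul ((continuous_snd.norm.pow 2).rpow_const fun _ => Or.inr (by linarith)))
  have cZ : ContinuousOn Zw Ω :=
    ((continuousOn_const.mul ((contDiffOn_kA 1).continuousOn.comp ct fun z hz => hz.1)).add
      (continuousOn_const.mul cφ0.continuousOn))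
  have iZ := integrable_mul_norm_sq_of_open hΩ hV hVc hVΩ (w := Zw) cZ
  have iN := integrable_mul_norm_sq_of_open hΩ hV hVc hVΩ (w := fun z => z.1 * ‖gradX φ z‖ ^ 2) (ct.mul cN)
  have hlow : (∫ z, Zw z * ‖V z‖ ^ 2) + (∫ z, z.1 * ‖gradX φ z‖ ^ 2 * ‖V z‖ ^ 2) ≤ ∫ z, M z * ‖V z‖ ^ 2 := by
    rw [← integral_add iZ iN]
    refine integral_mono (iZ.add iN) iM fun z => ?_
    show Zw z * ‖V z‖ ^ 2 + z.1 * ‖gradX φ z‖ ^ 2 * ‖V z‖ ^ 2 ≤ M z * ‖V z‖ ^ 2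
    by_cases hz : z ∈ tsupport V
    · obtain ⟨hz0, hz1, hzc, hzs⟩ := hVin z hz
      have h := cone_weight_lower_bound he hβ hβ1 hε0 hη hκ hm hc₂ ha0 ha hz0 hz1 hzc.le hzs.le
      have h' := mul_le_mul_of_nonneg_right h (sq_nonneg ‖V z‖)
      have e1 : Zw z * ‖V z‖ ^ 2 + z.1 * ‖gradX φ z‖ ^ 2 * ‖V z‖ ^ 2 =
          ((8 * β ^ 2 * (1 - η) ^ 2 - 8 * β * η * (1 - η) - 4 * β ^ 2 * η ^ 2) / 2 * a ^ 2 * kA 1 z.1 +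
            a * conePhi0 β η e z.2 + z.1 * ‖gradX (conePhi a β η e) z‖ ^ 2) * ‖V z‖ ^ 2 := by
        simp only [hZw, hφdef]; ring
      have e2 : M z * ‖V z‖ ^ 2 =
          (4 * z.1 ^ 2 * (∑ i, ∑ j, dx (stdOrthonormalBasis ℝ E i) (dx (stdOrthonormalBasis ℝ E j)
            (conePhi a β η e)) z * dx (stdOrthonormalBasis ℝ E i) (conePhi a β η e) z *
              dx (stdOrthonormalBasis ℝ E j) (conePhi a β η e) z) +
            z.1 ^ 2 * (dt (dt (conePhi a β η e)) z - 2 * dt (fun y => ‖gradX (conePhi a β η e) y‖ ^ 2) z -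
              lap (lap (conePhi a β η e)) z) -
            z.1 * qW (conePhi a β η e) z - z.1 * lap (coneG a β η) z -
            2 * z.1 * coneG a β η z * qW (conePhi a β η e) z + coneG a β η z - coneG a β η z ^ 2) * ‖V z‖ ^ 2 := by
        simp only [hMdef, hφdef, hGdef, hb]
      rw [e1, e2]
      exact h'
    · simp [hV00 z hz]
  -- ## (A.1.11): the gradient of `u` through `v`
  have iGVt : Integrable fun z : ℝ × E => z.1 * gradSq V z := integrable_mul_gradSq hV hVc continuous_id
  have hdU0 : ∀ z ∉ tsupport U, fderiv ℝ U z = 0 := fun z hz => fderiv_of_notMem_tsupport (𝕜 := ℝ) hz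
  have hGU0 : ∀ z ∉ tsupport U, gradSq U z = 0 := fun z hz => by simp [gradSq, dx, hdU0 z hz]
  have cGUf : Continuous fun z => gradSq U z := by
    unfold gradSq
    exact continuous_finsetSum _ fun i _ => ((contDiff_dx hU _).continuous.norm.pow 2)
  have cGU : Continuous fun z => z.1 * Real.exp (φ z) ^ 2 * gradSq U z := by
    refine continuous_of_continuousOn_of_eq_zero hΩ (isClosed_tsupport U) hUΩ ?_ fun z hz => by
      simp [hGU0 z hz]
    exact (ct.mul (hφ.continuousOn.rexp.pow 2)).mul cGUf.continuousOn
  have hGUc : HasCompactSupport fun z => z.1 * Real.exp (φ z) ^ 2 * gradSq U z := by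
    refine hUc.mono' fun z hz => ?_
    by_contra h
    exact hz (by simp [hGU0 z h])
  have iGU : Integrable fun z => z.1 * Real.exp (φ z) ^ 2 * gradSq U z :=
    cGU.integrable_of_hasCompactSupport hGUc
  have h11 : ∫ z, z.1 * Real.exp (φ z) ^ 2 * gradSq U z ≤
      2 * (∫ z : ℝ × E, z.1 * gradSq V z) + 2 * ∫ z : ℝ × E, z.1 * ‖gradX φ z‖ ^ 2 * ‖V z‖ ^ 2 := by
    rw [← integral_const_mul, ← integral_const_mul, ← integral_add (iGVt.const_mul 2) (iN.const_mul 2)]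
    refine integral_mono iGU ((iGVt.const_mul 2).add (iN.const_mul 2)) fun z => ?_
    show z.1 * Real.exp (φ z) ^ 2 * gradSq U z ≤
      2 * (z.1 * gradSq V z) + 2 * (z.1 * ‖gradX φ z‖ ^ 2 * ‖V z‖ ^ 2)
    by_cases hz : z ∈ tsupport U
    · have h := exp_sq_mul_gradSq_le_of_mem hΩ hφ hU (hUΩ hz)
      rw [← hVdef] at h
      have ht : 0 ≤ z.1 := (hUin z hz).1.le
      nlinarith only [h, ht]
    · have hzV : z ∉ tsupport V := fun h => hz (hVs h)
      simp [hGU0 z hz, hGV0 z hzV, hV00 z hzV]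
  -- ## the left-hand side through `v`
  have hZU : ∫ z, Zw z * Real.exp (2 * conePhi a β η e z) * ‖U z‖ ^ 2 = ∫ z, Zw z * ‖V z‖ ^ 2 := by
    refine integral_congr_ae (Eventually.of_forall fun z => ?_)
    show Zw z * Real.exp (2 * conePhi a β η e z) * ‖U z‖ ^ 2 = Zw z * ‖V z‖ ^ 2
    rw [hnV, exp_two_mul_eq_sq]
    ring
  have hGU' : ∫ z, z.1 * Real.exp (2 * conePhi a β η e z) * gradSq U z =
      ∫ z, z.1 * Real.exp (φ z) ^ 2 * gradSq U z := by
    refine integral_congr_ae (Eventually.of_forall fun z => ?_)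
    show z.1 * Real.exp (2 * conePhi a β η e z) * gradSq U z = z.1 * Real.exp (φ z) ^ 2 * gradSq U z
    rw [exp_two_mul_eq_sq]
  -- ## conclusion: name the integrals and combine linearly
  have hLHS : (∫ z, ((8 * β ^ 2 * (1 - η) ^ 2 - 8 * β * η * (1 - η) - 4 * β ^ 2 * η ^ 2) / 2 * a ^ 2 * kA 1 z.1 +
        a * conePhi0 β η e z.2) * Real.exp (2 * conePhi a β η e z) * ‖U z‖ ^ 2) =
      ∫ z, Zw z * Real.exp (2 * conePhi a β η e z) * ‖U z‖ ^ 2 := rfl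
  rw [hLHS, hZU, hGU', ← hJ]
  generalize (∫ z, ‖opSW φ V z + opAW φ V z‖ ^ 2) = XJ at *
  generalize (∫ z, ‖opSW φ V z‖ ^ 2) = XS at *
  generalize (∫ z, ‖opAW φ V z‖ ^ 2) = XA at *
  generalize (∫ z, ⟪opSW φ V z, opAW φ V z⟫) = XSA at *
  generalize (∫ z, z.1 * gradSq V z) = X1 at *
  generalize (∫ z, z.1 ^ 2 * ∑ i, ∑ j, dx (b i) (dx (b j) φ) z * ⟪dx (b j) V z, dx (b i) V z⟫) = X2 at *
  generalize (∫ z, z.1 ^ 2 * (∑ i, ∑ j, dx (b i) (dx (b j) φ) z * dx (b i) φ z * dx (b j) φ z) * ‖V z‖ ^ 2) = X3 at *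
  generalize (∫ z, z.1 ^ 2 * (dt (dt φ) z - 2 * dt (fun y => ‖gradX φ y‖ ^ 2) z - lap (lap φ) z) * ‖V z‖ ^ 2) = X4 at *
  generalize (∫ z, z.1 * qW φ z * ‖V z‖ ^ 2) = X5 at *
  generalize (∫ z, z.1 * G z * gradSq V z) = X6 at *
  generalize (∫ z, z.1 * lap G z * ‖V z‖ ^ 2) = X7 at *
  generalize (∫ z, z.1 * G z * qW φ z * ‖V z‖ ^ 2) = X8 at *
  generalize (∫ z, G z * ‖V z‖ ^ 2) = X9 at *
  generalize (∫ z, G z ^ 2 * ‖V z‖ ^ 2) = X10 at *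
  generalize (∫ z, M z * ‖V z‖ ^ 2) = X11 at *
  generalize (∫ z, Zw z * ‖V z‖ ^ 2) = X12 at *
  generalize (∫ z, z.1 * ‖gradX φ z‖ ^ 2 * ‖V z‖ ^ 2) = X13 at *
  generalize (∫ z, z.1 * Real.exp (φ z) ^ 2 * gradSq U z) = X14 at *
  linarith [hJsplit, hA0, hI, hmult, hgrad, hMint, hlow, h11]

end ConeCarleman

end Carleman

end Literature.Analysis.FluidPDE
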